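import Literature.NumberTheory.Automorphic.IncompleteEisensteinSeries
import Literature.NumberTheory.Automorphic.ScatteringCoefficientGrowth
import Literature.NumberTheory.LFunctions.HorocycleRHProofs
import Literature.NumberTheory.LFunctions.MertensBoundRH
import Mathlib.Analysis.MellinInversion
import HarnessLib

/-!
# Plancherel for incomplete Eisenstein series of `SL₂(ℤ)` (Iwaniec, Theorem 7.3 / (7.12)–(7.15) in inner-product form)

Layer 28 of the proof of Selberg's lattice-point theorem for the modular group
(`Literature.NumberTheory.Automorphic.sl2BallCount_asymp`). For smooth weights `ψ₁ ≥ 0`, `ψ₂`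
compactly supported in `(0, ∞)` we prove

  `∫_𝒟 E(·|ψ₁) E(·|ψ₂) dμ = 4·(3/π) Mψ₁(-1) Mψ₂(-1) + (1/4π) ∫_ℝ ℰ_{ψ₁}(r) conj ℰ_{ψ₂}(r) dr`

(`integral_fd_incEisG_mul_incEisG_eq_spectral`), where `Mψ = mellin ψ`, `2Mψ(-1) = ⟨E(·|ψ), 1⟩` and
`ℰ_ψ(r) = ⟨E(·|ψ), E(·, ½ + ir)⟩` (`eisCoeff`, `IncompleteEisensteinSeries.lean`): the incomplete
Eisenstein series decompose orthogonally over the constant function `u₀ = (3/π)^{½}` and the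
Eisenstein eigenpacket `{E(·, ½ + ir)}` with the Plancherel measure `dr/4π` — the `SL₂(ℤ)` case of
Iwaniec's Theorem 7.3 ((7.15) paired with another incomplete Eisenstein series), obtained here
WITHOUT the meromorphic continuation of `E(z, s)` in `s` beyond what the tree has, as follows.

1. `⟨E₁, E₂⟩ = 2∫₀^∞ y⁻²ψ₂(2ψ₁ + 2R₁)` (Lemma 3.3 and the constant term (3.17),
   `IncompleteEisensteinSeries.lean`).
2. Mellin analysis of smooth bumps (`IsSmoothBump`): integration by parts
   `Mψ(w) = -w⁻¹M[ψ'](w+1)`, the decay `Mψ(σ+iτ) ≪_k (1+|τ|)^{-k}` ((3.13)/(7.3)), Mellin inversion on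
   every vertical line (Mathlib's `mellinInv_mellin_eq`), and the resulting Fubini identity
   `∫ G ψ = (1/2π)∫ Mψ(σ+iτ)(∫ G y^{-σ-iτ}) dτ` (`IsSmoothBump.integral_mul_eq_mellin`).
3. `∫₀^∞ ψ₁ψ₂ y⁻² = (1/2π)∫ Mψ₁(-½-iτ) Mψ₂(-½+iτ) dτ` (Mellin–Plancherel, polarized).
4. `R_ψ` is bounded by `4B/a`, vanishes for `y > 1/a`, is continuous, and
   `∫₀^∞ y^{s-2}R_ψ = φ(s)Mψ(-s)` for `Re s > 1`, `ψ ≥ 0` (the tree's `hasSum_integral_rowSum`,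
   `Σφ(c)c^{-2s} = ζ(2s-1)/ζ(2s)`, `∫(1+t²)^{-s} = √πΓ(s-½)/Γ(s)`, and (3.24)); hence
   `∫₀^∞ ψ₂R₁y⁻² = (1/2π)∫ Φ(5/4+iτ) dτ`, `Φ(s) = φ(s)Mψ₁(-s)Mψ₂(-s)`.
5. The contour shift of (3.12) to `Re s = ½` ((7.12)): `∫Φ(5/4+iτ) = ∫Φ(½+iτ) + 2π·(3/π)Mψ₁(-1)Mψ₂(-1)`
   by Cauchy's theorem on `[½, 5/4] × [-T, T]` (`MertensBoundRH.integral_vertical_eq_of_tendsto`)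
   for `G = Φ - Φ̃(1)/(s(s-1))` (holomorphic on the closed strip: `φ` is regular on `Re s ≥ ½` except
   for the simple pole at `1` with residue `3/π`, `ModularEisensteinFourier.lean`; decay from the
   polynomial growth of `φ`, `ScatteringCoefficientGrowth.lean`), with `∫ds/(s(s-1))` equal to `-2π`
   on `Re s = ½` and `0` on `Re s = 5/4` (antiderivative `log(1 - 1/s)`).
6. `|φ(½+ir)| = 1` turns `m₁conj m₂ + φ m₁m₂` (`m_i = Mψ_i(-½-ir)`) into `¼ ℰ_{ψ₁} conj ℰ_{ψ₂}` up to
   its complex conjugate, and the left side is real.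

## References

* [Iwaniec2002] H. Iwaniec, *Spectral Methods of Automorphic Forms*, 2nd ed., AMS GSM 53 (2002),
  §3.2 (3.10), (3.12)–(3.13), Lemma 3.3, PDF pp. 42–44; (3.17), (3.24), PDF p. 46; §7.3, Theorem 7.3
  and (7.12)–(7.15), PDF pp. 73–75.
-/

noncomputable section

open MeasureTheory Set Filter Real
open scoped Topology ComplexConjugate NNReal ENNReal


namespace Literature.NumberTheory.Automorphic

open MeasureTheory Set Filter Real Complex
open scoped Topology ComplexConjugate

/-! ## Smooth bump weights and their Mellin transforms -/

section SmoothBump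

/-- Smooth weights compactly supported in `(0, ∞)`: `ψ ∈ C^∞`, `supp ψ ⊆ [a, b]`, `a > 0` — Iwaniec's
`ψ ∈ C_c^∞(ℝ⁺)` of (3.10) and Lemma 3.3. [cite: Iwaniec2002, (3.10) & Lemma 3.3, PDF pp. 42, 44] -/
structure IsSmoothBump (ψ : ℝ → ℝ) : Prop where
  smooth : ContDiff ℝ (⊤ : ℕ∞) ψ
  support : ∃ a b : ℝ, 0 < a ∧ ∀ y, ψ y ≠ 0 → a ≤ y ∧ y ≤ b

variable {ψ ψ₁ ψ₂ : ℝ → ℝ}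

/-- A smooth bump is a bump weight. [folklore] -/
theorem IsSmoothBump.isBumpWeight (h : IsSmoothBump ψ) : IsBumpWeight ψ :=
  ⟨h.smooth.continuous, h.support⟩

/-- The topological support of a smooth bump lies in `[a, b]`. [folklore] -/
theorem IsSmoothBump.tsupport_subset {a b : ℝ} (h : ∀ y, ψ y ≠ 0 → a ≤ y ∧ y ≤ b) : tsupport ψ ⊆ Icc a b :=
  closure_minimal (fun y hy => h y hy) isClosed_Icc

/-- The derivative of a smooth bump is a smooth bump (with the same `[a, b]`). [folklore] -/
theorem IsSmoothBump.deriv (h : IsSmoothBump ψ) : IsSmoothBump (deriv ψ) := by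
  obtain ⟨a, b, ha, hsupp⟩ := h.support
  refine ⟨(contDiff_infty_iff_deriv.mp h.smooth).2, a, b, ha, fun y hy => ?_⟩
  exact IsSmoothBump.tsupport_subset hsupp (support_deriv_subset (f := ψ) hy)

/-- The complexification `v ↦ (ψ v : ℂ)`. [folklore] -/
def cplx (ψ : ℝ → ℝ) : ℝ → ℂ := fun v => ((ψ v : ℝ) : ℂ)

/-- Unfolding `cplx`. [folklore] -/
@[simp] theorem cplx_apply (ψ : ℝ → ℝ) (v : ℝ) : cplx ψ v = ((ψ v : ℝ) : ℂ) := rfl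

/-- The Mellin transform `Mψ(w) = ∫₀^∞ ψ(v) v^{w-1} dv` of a bump converges everywhere. [folklore] -/
theorem IsBumpWeight.mellinConvergent (h : IsBumpWeight ψ) (w : ℂ) : MellinConvergent (cplx ψ) w := by
  obtain ⟨a, b, ha, hsupp⟩ := h.support
  exact Literature.NumberTheory.LFunctions.mellinConvergent_bump h.continuous ha (fun t ht => (hsupp t ht).1)
    (fun t ht => (hsupp t ht).2) w

/-- … and is entire. [folklore] -/
theorem IsBumpWeight.differentiable_mellin (h : IsBumpWeight ψ) : Differentiable ℂ (mellin (cplx ψ)) := by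
  obtain ⟨a, b, ha, hsupp⟩ := h.support
  exact Literature.NumberTheory.LFunctions.differentiable_mellin_bump h.continuous ha (fun t ht => (hsupp t ht).1)
    (fun t ht => (hsupp t ht).2)

/-- `Mψ(w̄) = conj Mψ(w)` for real `ψ`. [folklore] -/
theorem mellin_cplx_conj (ψ : ℝ → ℝ) (w : ℂ) : mellin (cplx ψ) (conj w) = conj (mellin (cplx ψ) w) :=
  Literature.Barriers.RiemannHypothesis.mellin_conj (fun t => by simp [cplx]) w

/-- The Mellin integral over `(0, ∞)` is an integral over any `[a', b'] ⊇ supp ψ` with `a' > 0`. [folklore] -/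
theorem mellin_eq_intervalIntegral {a b a' b' : ℝ} (ha' : 0 < a') (haa : a' ≤ a) (hbb : b ≤ b') (hab : a' ≤ b')
    (hsupp : ∀ y, ψ y ≠ 0 → a ≤ y ∧ y ≤ b) (w : ℂ) :
    mellin (cplx ψ) w = ∫ t in a'..b', ((t : ℝ) : ℂ) ^ (w - 1) * ((ψ t : ℝ) : ℂ) := by
  have hzero : ∀ t ∈ Ioi (0 : ℝ) \ Icc a' b', ((t : ℝ) : ℂ) ^ (w - 1) • cplx ψ t = 0 := by
    intro t ht
    have : ψ t = 0 := by
      by_contra h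
      have := hsupp t h
      exact ht.2 ⟨haa.trans this.1, this.2.trans hbb⟩
    simp [cplx, this]
  calc mellin (cplx ψ) w = ∫ t in Ioi (0 : ℝ), ((t : ℝ) : ℂ) ^ (w - 1) • cplx ψ t := rfl
    _ = ∫ t in Icc a' b', ((t : ℝ) : ℂ) ^ (w - 1) • cplx ψ t :=
        setIntegral_eq_of_subset_of_forall_sdiff_eq_zero measurableSet_Ioi
          (fun t ht => lt_of_lt_of_le ha' ht.1) hzero
    _ = ∫ t in Ioc a' b', ((t : ℝ) : ℂ) ^ (w - 1) • cplx ψ t := integral_Icc_eq_integral_Ioc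
    _ = ∫ t in a'..b', ((t : ℝ) : ℂ) ^ (w - 1) • cplx ψ t := (intervalIntegral.integral_of_le hab).symm
    _ = ∫ t in a'..b', ((t : ℝ) : ℂ) ^ (w - 1) * ((ψ t : ℝ) : ℂ) := by
        congr 1

/-- **Integration by parts**: `Mψ(w) = -(1/w) M[ψ'](w + 1)` for `w ≠ 0`. [folklore] -/
theorem IsSmoothBump.mellin_eq_neg_mellin_deriv (h : IsSmoothBump ψ) {w : ℂ} (hw : w ≠ 0) :
    mellin (cplx ψ) w = -(1 / w) * mellin (cplx (_root_.deriv ψ)) (w + 1) := by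
  obtain ⟨a, b, ha, hsupp⟩ := h.support
  have hsupp' : ∀ y, _root_.deriv ψ y ≠ 0 → a ≤ y ∧ y ≤ b := fun y hy =>
    IsSmoothBump.tsupport_subset hsupp (support_deriv_subset (f := ψ) hy)
  set a' := a / 2 with ha'
  set b' := max b a + 1 with hb'
  have ha'0 : 0 < a' := by positivity
  have haa : a' ≤ a := by rw [ha']; linarith
  have hbb : b ≤ b' := by rw [hb']; linarith [le_max_left b a]
  have hab : a' ≤ b' := by rw [hb']; linarith [le_max_right b a]
  rw [mellin_eq_intervalIntegral ha'0 haa hbb hab hsupp w,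
    mellin_eq_intervalIntegral ha'0 haa hbb hab hsupp' (w + 1)]
  -- by parts with `u = ψ`, `v = t^w / w`
  have hψd : ∀ t ∈ uIcc a' b', HasDerivAt (fun t : ℝ => ((ψ t : ℝ) : ℂ)) (((_root_.deriv ψ t : ℝ) : ℂ)) t :=
    fun t _ => (h.smooth.differentiable (by simp) t).hasDerivAt.ofReal_comp
  have hvd : ∀ t ∈ uIcc a' b', HasDerivAt (fun t : ℝ => ((t : ℝ) : ℂ) ^ (w - 1 + 1) / (w - 1 + 1)) (((t : ℝ) : ℂ) ^ (w - 1)) t := by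
    intro t ht
    rw [uIcc_of_le hab] at ht
    have ht0 : t ≠ 0 := (lt_of_lt_of_le ha'0 ht.1).ne'
    exact hasDerivAt_ofReal_cpow_const' ht0 (by intro h'; apply hw; linear_combination h')
  have hu'i : IntervalIntegrable (fun t : ℝ => ((_root_.deriv ψ t : ℝ) : ℂ)) volume a' b' :=
    (Complex.continuous_ofReal.comp h.deriv.smooth.continuous).intervalIntegrable _ _
  have hv'i : IntervalIntegrable (fun t : ℝ => ((t : ℝ) : ℂ) ^ (w - 1)) volume a' b' := by
    refine ContinuousOn.intervalIntegrable ?_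
    rw [uIcc_of_le hab]
    intro t ht
    exact (Complex.continuousAt_ofReal_cpow_const t (w - 1) (Or.inr (lt_of_lt_of_le ha'0 ht.1).ne')).continuousWithinAt
  have hparts := intervalIntegral.integral_mul_deriv_eq_deriv_mul hψd hvd hu'i hv'i
  have hψa' : ψ a' = 0 := by
    by_contra hne; have := (hsupp _ hne).1; rw [ha'] at this; linarith
  have hψb' : ψ b' = 0 := by
    by_contra hne; have := (hsupp _ hne).2; rw [hb'] at this; linarith [le_max_left b a]
  simp only [hψa', hψb', Complex.ofReal_zero, zero_mul, sub_zero, zero_sub, sub_add_cancel] at hparts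
  calc ∫ t in a'..b', ((t : ℝ) : ℂ) ^ (w - 1) * ((ψ t : ℝ) : ℂ)
      = ∫ t in a'..b', ((ψ t : ℝ) : ℂ) * ((t : ℝ) : ℂ) ^ (w - 1) := by
        congr 1; funext t; ring
    _ = -∫ t in a'..b', ((_root_.deriv ψ t : ℝ) : ℂ) * (((t : ℝ) : ℂ) ^ w / w) := hparts
    _ = -(1 / w) * ∫ t in a'..b', ((t : ℝ) : ℂ) ^ (w + 1 - 1) * ((_root_.deriv ψ t : ℝ) : ℂ) := by
        rw [← intervalIntegral.integral_const_mul, ← intervalIntegral.integral_neg]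
        congr 1; funext t; rw [add_sub_cancel_right]; field_simp

/-- A crude uniform bound `|Mψ(σ + iτ)| ≤ C` for `σ` in a compact interval. [folklore] -/
theorem IsBumpWeight.exists_norm_mellin_le (h : IsBumpWeight ψ) (σ₁ σ₂ : ℝ) :
    ∃ C : ℝ, 0 ≤ C ∧ ∀ σ ∈ Icc σ₁ σ₂, ∀ τ : ℝ, ‖mellin (cplx ψ) (σ + τ * Complex.I)‖ ≤ C := by
  rcases lt_or_ge σ₂ σ₁ with h12 | h12
  · exact ⟨0, le_rfl, fun σ hσ => absurd (hσ.1.trans hσ.2) (not_le.mpr h12)⟩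
  obtain ⟨a, b, ha, hsupp⟩ := h.support
  obtain ⟨B, hB0, hB⟩ := h.bounded
  set a' := a / 2 with ha'
  set b' := max b a + 1 with hb'
  have ha'0 : 0 < a' := by positivity
  have haa : a' ≤ a := by rw [ha']; linarith
  have hbb : b ≤ b' := by rw [hb']; linarith [le_max_left b a]
  have hab : a' ≤ b' := by rw [hb']; linarith [le_max_right b a]
  -- `t^{σ-1} ≤ K` on `[σ₁, σ₂] × [a', b']`
  have hKc : IsCompact (Icc σ₁ σ₂ ×ˢ Icc a' b') := isCompact_Icc.prod isCompact_Icc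
  have hcont : ContinuousOn (fun p : ℝ × ℝ => p.2 ^ (p.1 - 1)) (Icc σ₁ σ₂ ×ˢ Icc a' b') := by
    intro p hp
    refine ContinuousAt.continuousWithinAt ?_
    exact ContinuousAt.rpow continuousAt_snd (continuousAt_fst.sub continuousAt_const)
      (Or.inl (lt_of_lt_of_le ha'0 hp.2.1).ne')
  obtain ⟨K, hK⟩ := hKc.exists_bound_of_continuousOn hcont
  have hK0 : 0 ≤ K := (norm_nonneg _).trans (hK (σ₁, a') ⟨⟨le_rfl, h12⟩, ⟨le_rfl, hab⟩⟩)
  refine ⟨K * B * |b' - a'|, by positivity, fun σ hσ τ => ?_⟩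
  rw [mellin_eq_intervalIntegral ha'0 haa hbb hab hsupp]
  refine intervalIntegral.norm_integral_le_of_norm_le_const fun t ht => ?_
  rw [uIoc_of_le hab] at ht
  have ht0 : 0 < t := lt_of_lt_of_le ha'0 ht.1.le
  rw [norm_mul, Complex.norm_cpow_eq_rpow_re_of_pos ht0, Complex.norm_real, Real.norm_eq_abs,
    show (σ + τ * Complex.I - 1).re = σ - 1 by simp]
  have h1 : t ^ (σ - 1) ≤ K := by
    have := hK (σ, t) ⟨hσ, ⟨ht.1.le, ht.2⟩⟩
    rw [Real.norm_eq_abs, abs_of_pos (Real.rpow_pos_of_pos ht0 _)] at this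
    exact this
  exact mul_le_mul h1 (hB t) (abs_nonneg _) hK0

/-- **Decay of the Mellin transform of a smooth bump**: for every `k` and compact `σ`-range,
`|Mψ(σ + iτ)| ≤ C (1 + |τ|)^{-k}` (`k` integrations by parts: "`ψ̂(s) ≪ (|s|+1)^{-A}` by repeated partial
integration", after (3.13); (7.3)). [cite: Iwaniec2002, (3.13) & (7.3), PDF pp. 43, 73-74] -/
theorem IsSmoothBump.exists_norm_mellin_le_pow (h : IsSmoothBump ψ) (k : ℕ) (σ₁ σ₂ : ℝ) :
    ∃ C : ℝ, 0 ≤ C ∧ ∀ σ ∈ Icc σ₁ σ₂, ∀ τ : ℝ, ‖mellin (cplx ψ) (σ + τ * Complex.I)‖ ≤ C / (1 + |τ|) ^ k := by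
  induction k generalizing ψ σ₁ σ₂ with
  | zero =>
    obtain ⟨C, hC0, hC⟩ := h.isBumpWeight.exists_norm_mellin_le σ₁ σ₂
    exact ⟨C, hC0, fun σ hσ τ => by simpa using hC σ hσ τ⟩
  | succ k ih =>
    obtain ⟨C', hC'0, hC'⟩ := ih h.deriv (σ₁ + 1) (σ₂ + 1)
    obtain ⟨C₀, hC₀0, hC₀⟩ := h.isBumpWeight.exists_norm_mellin_le σ₁ σ₂
    refine ⟨max (2 * C') (2 ^ (k + 1) * C₀), le_max_of_le_left (by positivity), fun σ hσ τ => ?_⟩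
    have h1τ : 0 < 1 + |τ| := by positivity
    rcases le_or_gt 1 |τ| with hτ | hτ
    · -- integrate by parts once
      have hw : (σ : ℂ) + τ * Complex.I ≠ 0 := by
        intro hw; have := congrArg Complex.im hw; simp at this; rw [this] at hτ; norm_num at hτ
      rw [h.mellin_eq_neg_mellin_deriv hw, norm_mul, norm_neg, norm_div, norm_one,
        show (σ : ℂ) + τ * Complex.I + 1 = ((σ + 1 : ℝ) : ℂ) + τ * Complex.I by push_cast; ring]
      have hd := hC' (σ + 1) ⟨by linarith [hσ.1], by linarith [hσ.2]⟩ τ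
      have hnorm : |τ| ≤ ‖(σ : ℂ) + τ * Complex.I‖ := by
        calc |τ| = |((σ : ℂ) + τ * Complex.I).im| := by simp
          _ ≤ ‖(σ : ℂ) + τ * Complex.I‖ := Complex.abs_im_le_norm _
      have hτ0 : 0 < |τ| := by linarith
      calc 1 / ‖(σ : ℂ) + τ * Complex.I‖ * ‖mellin (cplx (_root_.deriv ψ)) (((σ + 1 : ℝ) : ℂ) + τ * Complex.I)‖
          ≤ 1 / |τ| * (C' / (1 + |τ|) ^ k) := by
            gcongr
        _ ≤ 2 / (1 + |τ|) * (C' / (1 + |τ|) ^ k) := by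
            have hfrac : 1 / |τ| ≤ 2 / (1 + |τ|) := by
              rw [div_le_div_iff₀ hτ0 h1τ]; linarith
            exact mul_le_mul_of_nonneg_right hfrac (by positivity)
        _ = 2 * C' / (1 + |τ|) ^ (k + 1) := by rw [pow_succ]; field_simp
        _ ≤ max (2 * C') (2 ^ (k + 1) * C₀) / (1 + |τ|) ^ (k + 1) := by
            gcongr; exact le_max_left _ _
    · -- small `τ`: the crude bound
      have h2 : (1 + |τ|) ^ (k + 1) ≤ 2 ^ (k + 1) := by
        gcongr; linarith
      calc ‖mellin (cplx ψ) (σ + τ * Complex.I)‖ ≤ C₀ := hC₀ σ hσ τ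
        _ = 2 ^ (k + 1) * C₀ / 2 ^ (k + 1) := by field_simp
        _ ≤ 2 ^ (k + 1) * C₀ / (1 + |τ|) ^ (k + 1) := by gcongr
        _ ≤ max (2 * C') (2 ^ (k + 1) * C₀) / (1 + |τ|) ^ (k + 1) := by
            gcongr; exact le_max_right _ _

/-- The Mellin transform of a smooth bump is integrable on every vertical line. [folklore] -/
theorem IsSmoothBump.verticalIntegrable_mellin (h : IsSmoothBump ψ) (σ : ℝ) : VerticalIntegrable (mellin (cplx ψ)) σ := by
  obtain ⟨C, hC0, hC⟩ := h.exists_norm_mellin_le_pow 2 σ σ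
  have hcont : Continuous fun τ : ℝ => mellin (cplx ψ) (σ + τ * Complex.I) :=
    h.isBumpWeight.differentiable_mellin.continuous.comp (by fun_prop)
  refine Integrable.mono' ((integrable_inv_one_add_sq).const_mul C) hcont.aestronglyMeasurable
    (Eventually.of_forall fun τ => ?_)
  calc ‖mellin (cplx ψ) (σ + τ * Complex.I)‖ ≤ C / (1 + |τ|) ^ 2 := hC σ ⟨le_rfl, le_rfl⟩ τ
    _ ≤ C * (1 + τ ^ 2)⁻¹ := by
        rw [div_eq_mul_inv]
        gcongr
        nlinarith [abs_nonneg τ, sq_abs τ]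

/-- **Mellin inversion for smooth bumps** on an arbitrary vertical line `Re = σ`:
`ψ(y) = (1/2π) ∫ y^{-(σ+iτ)} Mψ(σ+iτ) dτ` (`y > 0`). [folklore] -/
theorem IsSmoothBump.mellin_inversion (h : IsSmoothBump ψ) (σ : ℝ) {y : ℝ} (hy : 0 < y) :
    cplx ψ y = ((1 / (2 * π) : ℝ) : ℂ) *
      ∫ τ : ℝ, ((y : ℝ) : ℂ) ^ (-((σ : ℂ) + τ * Complex.I)) * mellin (cplx ψ) (σ + τ * Complex.I) := by
  have hinv := mellinInv_mellin_eq σ (cplx ψ) hy (h.isBumpWeight.mellinConvergent σ) (h.verticalIntegrable_mellin σ)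
    ((Complex.continuous_ofReal.comp h.smooth.continuous).continuousAt)
  rw [← hinv, mellinInv, Complex.real_smul]
  simp only [smul_eq_mul]

end SmoothBump

/-! ## Fubini with Mellin inversion: `∫ G ψ = (1/2π) ∫ Mψ(σ+iτ) (∫ G y^{-σ-iτ}) dτ` -/

section MellinFubini

variable {ψ : ℝ → ℝ}

/-- The product of Lebesgue measure on `(0, ∞)` and on `ℝ` as a restricted product. [folklore] -/
theorem prod_restrict_Ioi_eq :
    ((volume : Measure ℝ).restrict (Ioi 0)).prod (volume : Measure ℝ) =
      ((volume : Measure ℝ).prod (volume : Measure ℝ)).restrict (Ioi 0 ×ˢ univ) := by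
  conv_lhs => rw [← Measure.restrict_univ (μ := (volume : Measure ℝ))]
  rw [Measure.prod_restrict, Measure.restrict_univ]

/-- **Pairing a function against a smooth bump through the Mellin transform**: if `G` is
continuous on `(0, ∞)` and `G(y) y^{-σ}` is integrable there, then
`∫₀^∞ G(y) ψ(y) dy = (1/2π) ∫ Mψ(σ+iτ) (∫₀^∞ G(y) y^{-σ-iτ} dy) dτ` (insert Mellin inversion for `ψ`
on `Re = σ` and swap the integrals). This is the form of Parseval's formula for the Mellin transform
behind the passage from (3.12) to (7.12). [cite: Iwaniec2002, (3.12) & (7.12), PDF pp. 43, 73-74] -/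
theorem IsSmoothBump.integral_mul_eq_mellin (h : IsSmoothBump ψ) (σ : ℝ) {G : ℝ → ℂ} (hGc : ContinuousOn G (Ioi 0))
    (hGi : IntegrableOn (fun y : ℝ => G y * ((y : ℝ) : ℂ) ^ (-(σ : ℂ))) (Ioi 0)) :
    ∫ y in Ioi (0 : ℝ), G y * cplx ψ y =
      ((1 / (2 * π) : ℝ) : ℂ) * ∫ τ : ℝ, mellin (cplx ψ) (σ + τ * Complex.I) *
        ∫ y in Ioi (0 : ℝ), G y * ((y : ℝ) : ℂ) ^ (-((σ : ℂ) + τ * Complex.I)) := by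
  set c : ℂ := ((1 / (2 * π) : ℝ) : ℂ) with hc
  set M : ℝ → ℂ := fun τ => mellin (cplx ψ) (σ + τ * Complex.I) with hM
  have hMi : Integrable M := h.verticalIntegrable_mellin σ
  have hMc : Continuous M := h.isBumpWeight.differentiable_mellin.continuous.comp (by fun_prop)
  set F : ℝ → ℝ → ℂ := fun y τ => c * M τ * (G y * ((y : ℝ) : ℂ) ^ (-((σ : ℂ) + τ * Complex.I))) with hF
  -- Step 1: insert Mellin inversion
  have h1 : ∀ y ∈ Ioi (0 : ℝ), G y * cplx ψ y = ∫ τ, F y τ := by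
    intro y hy
    have hy' : (0 : ℝ) < y := hy
    rw [h.mellin_inversion σ hy', ← integral_const_mul, ← integral_const_mul]
    congr 1; funext τ; simp only [hF, hM]; ring
  rw [setIntegral_congr_fun measurableSet_Ioi h1]
  -- Step 2: integrability on the product
  have hcpow : ∀ p : ℝ × ℝ, p ∈ Ioi (0 : ℝ) ×ˢ (univ : Set ℝ) →
      ContinuousAt (fun q : ℝ × ℝ => ((q.1 : ℝ) : ℂ) ^ (-((σ : ℂ) + q.2 * Complex.I))) p := by
    intro p hp
    have hp1 : (0 : ℝ) < p.1 := hp.1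
    refine ContinuousAt.cpow (Complex.continuous_ofReal.continuousAt.comp continuousAt_fst) (by fun_prop) ?_
    exact Complex.ofReal_mem_slitPlane.mpr hp1
  have hFm : AEStronglyMeasurable (Function.uncurry F) (((volume : Measure ℝ).restrict (Ioi 0)).prod volume) := by
    rw [prod_restrict_Ioi_eq]
    refine ContinuousOn.aestronglyMeasurable ?_ (measurableSet_Ioi.prod MeasurableSet.univ)
    intro p hp
    have hG' : ContinuousAt (fun q : ℝ × ℝ => G q.1) p :=
      (hGc.continuousAt (Ioi_mem_nhds hp.1)).comp continuousAt_fst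
    have hM' : ContinuousAt (fun q : ℝ × ℝ => M q.2) p := hMc.continuousAt.comp continuousAt_snd
    exact ((continuousAt_const.mul hM').mul (hG'.mul (hcpow p hp))).continuousWithinAt
  have hFi : Integrable (Function.uncurry F) (((volume : Measure ℝ).restrict (Ioi 0)).prod volume) := by
    have hg : Integrable (fun p : ℝ × ℝ => (G p.1 * ((p.1 : ℝ) : ℂ) ^ (-(σ : ℂ))) * (c * M p.2))
        (((volume : Measure ℝ).restrict (Ioi 0)).prod volume) := hGi.mul_prod (hMi.const_mul c)
    refine hg.norm.mono' hFm ?_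
    rw [prod_restrict_Ioi_eq] at hg ⊢
    filter_upwards [ae_restrict_mem (measurableSet_Ioi.prod MeasurableSet.univ)] with p hp
    have hp1 : (0 : ℝ) < p.1 := hp.1
    simp only [Function.uncurry, hF, norm_mul, Complex.norm_cpow_eq_rpow_re_of_pos hp1]
    have e : (-((σ : ℂ) + p.2 * Complex.I)).re = (-(σ : ℂ)).re := by simp
    rw [e]
    ring_nf
    rfl
  -- Step 3: swap and evaluate the inner integral
  rw [integral_integral_swap hFi]
  rw [← integral_const_mul]
  congr 1; funext τ
  simp only [hF]
  rw [integral_const_mul]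
  ring

end MellinFubini

/-! ## Mellin–Plancherel for two smooth bumps (the term `∫ ψ₁ψ₂ y⁻²`) -/

section T1

variable {ψ₁ ψ₂ : ℝ → ℝ}

/-- **`∫₀^∞ ψ₁ψ₂ y⁻² dy = (1/2π) ∫ Mψ₁(-½-iτ) Mψ₂(-½+iτ) dτ`** (Plancherel for the Mellin transform
on the line `Re = -½`, polarized; the `δ_{𝔞𝔟}`-part of the pairing (7.4) of (7.12)). [cite: Iwaniec2002, (7.4) & (7.12), PDF pp. 73-74] -/
theorem integral_inv_sq_mul_bump_mul_bump (h₁ : IsSmoothBump ψ₁) (h₂ : IsSmoothBump ψ₂) :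
    ∫ y in Ioi (0 : ℝ), ((((y ^ 2)⁻¹ * ψ₁ y : ℝ) : ℂ)) * cplx ψ₂ y =
      ((1 / (2 * π) : ℝ) : ℂ) * ∫ τ : ℝ, mellin (cplx ψ₁) (((-(1 / 2) : ℝ) : ℂ) - τ * Complex.I) *
        mellin (cplx ψ₂) (((-(1 / 2) : ℝ) : ℂ) + τ * Complex.I) := by
  have hGc : ContinuousOn (fun y : ℝ => (((y ^ 2)⁻¹ * ψ₁ y : ℝ) : ℂ)) (Ioi 0) := by
    intro y hy
    have hy' : (0 : ℝ) < y := hy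
    exact (Complex.continuous_ofReal.continuousAt.comp
      (((continuousAt_id.pow 2).inv₀ (by simp [hy'.ne'])).mul h₁.smooth.continuous.continuousAt)).continuousWithinAt
  have hGi : IntegrableOn (fun y : ℝ => (((y ^ 2)⁻¹ * ψ₁ y : ℝ) : ℂ) * ((y : ℝ) : ℂ) ^ (-(((-(1 / 2) : ℝ) : ℂ)))) (Ioi 0) := by
    have hG : ContinuousOn (fun y : ℝ => (((y ^ 2)⁻¹ : ℝ) : ℂ) * ((y : ℝ) : ℂ) ^ (-(((-(1 / 2) : ℝ) : ℂ)))) (Ioi 0) := by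
      intro y hy
      have hy' : (0 : ℝ) < y := hy
      refine ContinuousAt.continuousWithinAt (ContinuousAt.mul ?_ ?_)
      · exact Complex.continuous_ofReal.continuousAt.comp ((continuousAt_id.pow 2).inv₀ (by simp [hy'.ne']))
      · exact Complex.continuousAt_ofReal_cpow_const y _ (Or.inr hy'.ne')
    refine (h₁.isBumpWeight.integrableOn_mul hG).congr_fun (fun y _ => ?_) measurableSet_Ioi
    push_cast; ring
  rw [h₂.integral_mul_eq_mellin (-(1 / 2)) hGc hGi]
  congr 1
  refine integral_congr_ae (Eventually.of_forall fun τ => ?_)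
  simp only
  rw [integral_inv_sq_mul_cpow ψ₁]
  rw [mul_comm]
  congr 2
  push_cast; ring

end T1



/-! ## The non-trivial constant term `R_ψ`: bounds, support, continuity, Mellin transform -/

section RowSum

open Literature.NumberTheory.LFunctions (rowFun rowIntegral rowFun_support sq_le_of_rowFun_ne_zero
  continuousOn_horocycleAverage hasSum_integral_rowSum totientSum_mul_zeta betaR_mul_Gamma betaR incEis)

variable {ψ : ℝ → ℝ} {a b : ℝ}

/-- On the support of the row integrand `|u| ≤ √(y/a)/c` (`c ≥ 1`). [folklore] -/
theorem abs_le_div_of_rowFun_ne_zero (ha : 0 < a) (hψa : ∀ t, ψ t ≠ 0 → a ≤ t) {c : ℕ} (hc : 1 ≤ c)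
    {y u : ℝ} (hy : 0 < y) (h : rowFun ψ c y u ≠ 0) : |u| ≤ Real.sqrt (y / a) / c := by
  have h1 := rowFun_support ha hψa hy h
  have hc0 : (0 : ℝ) < c := by exact_mod_cast hc
  rw [le_div_iff₀ hc0, ← Real.sqrt_sq_eq_abs, ← Real.sqrt_sq hc0.le, ← Real.sqrt_mul (sq_nonneg _)]
  apply Real.sqrt_le_sqrt
  nlinarith [sq_nonneg u, sq_nonneg y, sq_nonneg (c : ℝ)]

/-- **Row integrals are small**: `|g_c(y)| ≤ 2B√(y/a)/c` for `|ψ| ≤ B`, `supp ψ ⊆ [a, ∞)`, `c ≥ 1`. [folklore] -/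
theorem abs_rowIntegral_le (ha : 0 < a) (hψa : ∀ t, ψ t ≠ 0 → a ≤ t) {B : ℝ} (hB : ∀ t, |ψ t| ≤ B)
    {c : ℕ} (hc : 1 ≤ c) {y : ℝ} (hy : 0 < y) :
    |rowIntegral ψ c y| ≤ 2 * B * Real.sqrt (y / a) / c := by
  set U := Real.sqrt (y / a) / c with hU
  have hU0 : 0 ≤ U := by positivity
  have hsupp : ∀ u, u ∉ Icc (-U) U → rowFun ψ c y u = 0 := by
    intro u hu
    by_contra h
    exact hu (abs_le.mp (abs_le_div_of_rowFun_ne_zero ha hψa hc hy h))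
  unfold rowIntegral
  rw [← setIntegral_eq_integral_of_forall_compl_eq_zero (s := Icc (-U) U) (fun u hu => hsupp u hu)]
  have hbound : ∀ u ∈ Icc (-U) U, ‖rowFun ψ c y u‖ ≤ B := fun u _ => by
    rw [Real.norm_eq_abs]; exact hB _
  have h := norm_setIntegral_le_of_norm_le_const (measure_Icc_lt_top : volume (Icc (-U) U) < ⊤) hbound
  rw [Real.norm_eq_abs, Real.volume_real_Icc_of_le (by linarith)] at h
  calc |∫ u in Icc (-U) U, rowFun ψ c y u| ≤ B * (U - -U) := h
    _ = 2 * B * Real.sqrt (y / a) / c := by rw [hU]; ring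

/-- For `c² > 1/(ay)` the row integral vanishes. [folklore] -/
theorem rowIntegral_eq_zero_of_lt_sq (ha : 0 < a) (hψa : ∀ t, ψ t ≠ 0 → a ≤ t) {y : ℝ} (hy : 0 < y)
    {c : ℕ} (hc : 1 / (a * y) < (c : ℝ) ^ 2) : rowIntegral ψ c y = 0 := by
  have : ∀ u, rowFun ψ c y u = 0 := fun u => by
    by_contra h
    have h1 := sq_le_of_rowFun_ne_zero ha hψa hy h
    linarith
  simp [rowIntegral, this]

/-- **`R_ψ(y) = 0` for `y > 1/a`** (no `c ≥ 1` with `c² ≤ 1/(ay) < 1`). [cite: Iwaniec2002, (3.17), PDF p. 46] -/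
theorem eisR_eq_zero_of_lt (ha : 0 < a) (hψa : ∀ t, ψ t ≠ 0 → a ≤ t) {y : ℝ} (hy : 1 / a < y) :
    eisR ψ y = 0 := by
  have hy0 : 0 < y := lt_trans (by positivity) hy
  unfold eisR
  refine (tsum_congr fun c => ?_).trans tsum_zero
  rcases Nat.eq_zero_or_pos c with rfl | hc
  · simp
  · rw [rowIntegral_eq_zero_of_lt_sq ha hψa hy0 ?_, mul_zero]
    have hc1 : (1 : ℝ) ≤ (c : ℝ) ^ 2 := by
      have : (1 : ℝ) ≤ c := by exact_mod_cast hc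
      nlinarith
    have : 1 / (a * y) < 1 := by
      rw [div_lt_one (by positivity)]
      have := (div_lt_iff₀ ha).mp hy
      linarith
    linarith

/-- **`R_ψ` is bounded**: `|R_ψ(y)| ≤ 2B(1/a + √(y/a))` for `y > 0` (each of the `≤ √(1/(ay))` rows
`c ≥ 1` that contribute has `φ(c)|g_c(y)| ≤ 2B√(y/a)`). [folklore] -/
theorem abs_eisR_le (ha : 0 < a) (hψa : ∀ t, ψ t ≠ 0 → a ≤ t) {B : ℝ} (hB : ∀ t, |ψ t| ≤ B)
    {y : ℝ} (hy : 0 < y) :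
    |eisR ψ y| ≤ 2 * B * (1 / a + Real.sqrt (y / a)) := by
  have hB0 : 0 ≤ B := (abs_nonneg _).trans (hB 0)
  set N : ℕ := Nat.floor (Real.sqrt (1 / (a * y))) with hN
  -- rows beyond `N` vanish
  have hzero : ∀ c : ℕ, c ∉ Finset.range (N + 1) → (Nat.totient c : ℝ) * rowIntegral ψ c y = 0 := by
    intro c hc
    rw [Finset.mem_range, not_lt] at hc
    rw [rowIntegral_eq_zero_of_lt_sq ha hψa hy ?_, mul_zero]
    have h1 : Real.sqrt (1 / (a * y)) < c := by
      calc Real.sqrt (1 / (a * y)) < N + 1 := Nat.lt_floor_add_one _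
        _ ≤ c := by exact_mod_cast hc
    have h0 : 0 ≤ Real.sqrt (1 / (a * y)) := Real.sqrt_nonneg _
    calc 1 / (a * y) = Real.sqrt (1 / (a * y)) ^ 2 := (Real.sq_sqrt (by positivity)).symm
      _ < (c : ℝ) ^ 2 := by gcongr
  unfold eisR
  rw [tsum_eq_sum hzero]
  -- each remaining term is at most `2B√(y/a)`
  have hterm : ∀ c ∈ Finset.range (N + 1), |(Nat.totient c : ℝ) * rowIntegral ψ c y| ≤ 2 * B * Real.sqrt (y / a) := by
    intro c _
    rcases Nat.eq_zero_or_pos c with rfl | hc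
    · simp; positivity
    · rw [abs_mul, Nat.abs_cast]
      have hφ : (Nat.totient c : ℝ) ≤ c := by exact_mod_cast Nat.totient_le c
      have hc0 : (0 : ℝ) < c := by exact_mod_cast hc
      calc (Nat.totient c : ℝ) * |rowIntegral ψ c y| ≤ c * (2 * B * Real.sqrt (y / a) / c) :=
            mul_le_mul hφ (abs_rowIntegral_le ha hψa hB hc hy) (abs_nonneg _) hc0.le
        _ = 2 * B * Real.sqrt (y / a) := by field_simp
  calc |∑ c ∈ Finset.range (N + 1), (Nat.totient c : ℝ) * rowIntegral ψ c y|
      ≤ ∑ c ∈ Finset.range (N + 1), |(Nat.totient c : ℝ) * rowIntegral ψ c y| := Finset.abs_sum_le_sum_abs _ _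
    _ ≤ ∑ _c ∈ Finset.range (N + 1), 2 * B * Real.sqrt (y / a) := Finset.sum_le_sum hterm
    _ = (N + 1) * (2 * B * Real.sqrt (y / a)) := by rw [Finset.sum_const, Finset.card_range, nsmul_eq_mul]; push_cast; ring
    _ ≤ (Real.sqrt (1 / (a * y)) + 1) * (2 * B * Real.sqrt (y / a)) := by
        gcongr
        exact Nat.floor_le (Real.sqrt_nonneg _)
    _ = 2 * B * (1 / a + Real.sqrt (y / a)) := by
        have e : Real.sqrt (1 / (a * y)) * Real.sqrt (y / a) = 1 / a := by
          rw [← Real.sqrt_mul (by positivity), show 1 / (a * y) * (y / a) = (1 / a) ^ 2 by field_simp,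
            Real.sqrt_sq (by positivity)]
        linear_combination (2 * B) * e

/-- **A uniform bound `|R_ψ(y)| ≤ 4B/a` on `(0, ∞)`** (`R_ψ = 0` beyond `1/a`). [folklore] -/
theorem abs_eisR_le_const (ha : 0 < a) (hψa : ∀ t, ψ t ≠ 0 → a ≤ t) {B : ℝ} (hB : ∀ t, |ψ t| ≤ B)
    {y : ℝ} (hy : 0 < y) : |eisR ψ y| ≤ 4 * B / a := by
  have hB0 : 0 ≤ B := (abs_nonneg _).trans (hB 0)
  rcases lt_or_ge (1 / a) y with h | h
  · rw [eisR_eq_zero_of_lt ha hψa h, abs_zero]; positivity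
  · refine (abs_eisR_le ha hψa hB hy).trans ?_
    have hs : Real.sqrt (y / a) ≤ 1 / a := by
      rw [Real.sqrt_le_left (by positivity)]
      rw [div_le_iff₀ ha]
      have : y ≤ 1 / a := h
      calc y = y * a * (1 / a) * 1 := by field_simp
        _ ≤ (1 / a) * a * (1 / a) * 1 := by gcongr
        _ = (1 / a) ^ 2 * a := by ring
    calc 2 * B * (1 / a + Real.sqrt (y / a)) ≤ 2 * B * (1 / a + 1 / a) := by gcongr
      _ = 4 * B / a := by ring

/-- **`R_ψ` is continuous on `(0, ∞)`** for smooth `ψ` (it is half the horocycle average of `E(·|ψ)`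
minus `ψ`). [folklore] -/
theorem IsSmoothBump.continuousOn_eisR (h : IsSmoothBump ψ) : ContinuousOn (eisR ψ) (Ioi 0) := by
  obtain ⟨a, b, ha, hsupp⟩ := h.support
  have hav := continuousOn_horocycleAverage ha (fun t ht => (hsupp t ht).1) h.smooth
  have e : ∀ y ∈ Ioi (0 : ℝ), eisR ψ y = ((∫ x in (0 : ℝ)..1, incEis ψ (↑x + ↑y * Complex.I)).re - 2 * ψ y) / 2 := by
    intro y hy
    have hy' : (0 : ℝ) < y := hy
    have h1 := intervalIntegral_incEisG h.isBumpWeight hy'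
    have e1 : ∀ x : ℝ, incEis ψ (↑x + ↑y * Complex.I) = ((incEisG ψ (pt x y) : ℝ) : ℂ) := fun x => by
      rw [← coe_pt_eq_add hy', incEis_coe]
    simp_rw [e1]
    rw [h1, Complex.ofReal_re]
    ring
  refine ContinuousOn.congr ?_ e
  refine ContinuousOn.div_const (ContinuousOn.sub (Complex.continuous_re.comp_continuousOn hav) ?_) _
  exact (continuous_const.mul h.smooth.continuous).continuousOn

/-- **The Mellin transform of `R_ψ`**: for `Re s > 1` and `ψ ≥ 0`,
`∫₀^∞ y^{s-2} R_ψ(y) dy = φ(s) Mψ(-s)`, `φ` the scattering coefficient — the Mellin side of the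
constant term `φ(s)y^{1-s}` of `E(z, s)` ((3.20)), from the tree's `hasSum_integral_rowSum`
(`Σ_c φ(c)c^{-2s} = ζ(2s-1)/ζ(2s)`, `∫(1+t²)^{-s} = √πΓ(s-½)/Γ(s)`).
[cite: Iwaniec2002, (3.20) & (3.24), PDF p. 46] -/
theorem integral_cpow_mul_eisR (hψc : Continuous ψ) (ha : 0 < a) (hsupp : ∀ t, ψ t ≠ 0 → a ≤ t ∧ t ≤ b)
    (h0 : ∀ t, 0 ≤ ψ t) {s : ℂ} (hs : 1 < s.re) :
    ∫ y in Ioi (0 : ℝ), ((y : ℝ) : ℂ) ^ (s - 2) * ((eisR ψ y : ℝ) : ℂ) = scatPhi s * mellin (cplx ψ) (-s) := by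
  have hsum := hasSum_integral_rowSum hψc ha (fun t ht => (hsupp t ht).1) (fun t ht => (hsupp t ht).2) h0 hs
  have e1 : ∫ y in Ioi (0 : ℝ), ((y : ℝ) : ℂ) ^ (s - 2) * ((eisR ψ y : ℝ) : ℂ) =
      (∑' c : ℕ, (c.totient : ℂ) * ((((c : ℝ) ^ 2 : ℝ) : ℂ) ^ (-s))) * (betaR s * mellin (cplx ψ) (-s)) := by
    unfold eisR
    rw [← hsum.tsum_eq, ← tsum_mul_right]
    refine tsum_congr fun c => ?_
    rw [show cplx ψ = fun v => ((ψ v : ℝ) : ℂ) from rfl]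
    ring
  rw [e1]
  have hζ : riemannZeta (2 * s) ≠ 0 := riemannZeta_ne_zero_of_one_lt_re (by simp; linarith)
  have hΓ : Complex.Gamma s ≠ 0 := Complex.Gamma_ne_zero_of_re_pos (by linarith)
  have ht := totientSum_mul_zeta hs
  have hb := betaR_mul_Gamma (s := s) (by linarith)
  rw [scatPhi_eq_Gamma_zeta_of_one_lt_re hs]
  have e2 : (∑' c : ℕ, (c.totient : ℂ) * ((((c : ℝ) ^ 2 : ℝ) : ℂ) ^ (-s))) = riemannZeta (2 * s - 1) / riemannZeta (2 * s) := by
    rw [eq_div_iff hζ, ht]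
  have e3 : betaR s = ((Real.sqrt π : ℝ) : ℂ) * Complex.Gamma (s - 1 / 2) / Complex.Gamma s := by
    rw [eq_div_iff hΓ, hb]
  rw [e2, e3]
  field_simp

end RowSum

/-! ## The term `∫ ψ₂ R_{ψ₁} y⁻²` as a line integral on `Re s = 5/4` -/

section T2

variable {ψ₁ ψ₂ : ℝ → ℝ}

/-- The integrand `Φ(s) = φ(s) Mψ₁(-s) Mψ₂(-s)` of the shifted contour integral (3.12) → (7.12) for the
modular group, paired with `ψ₂` (the `φ`-part; the `δ`-part is the diagonal term). [cite: Iwaniec2002, (3.12) & (7.12), PDF pp. 43, 73-74] -/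
def plPhi (ψ₁ ψ₂ : ℝ → ℝ) (s : ℂ) : ℂ := scatPhi s * (mellin (cplx ψ₁) (-s) * mellin (cplx ψ₂) (-s))

/-- `y^{-3/4} R_{ψ}(y)` is integrable on `(0, ∞)` (bounded by `(4B/a) y^{-3/4}` on `(0, 1/a]`, zero beyond). [folklore] -/
theorem IsSmoothBump.integrableOn_rpow_mul_eisR (h : IsSmoothBump ψ₁) {σ : ℝ} (hσ : -1 < σ) :
    IntegrableOn (fun y : ℝ => ((y : ℝ) : ℂ) ^ (σ : ℂ) * ((eisR ψ₁ y : ℝ) : ℂ)) (Ioi 0) := by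
  obtain ⟨a, b, ha, hsupp⟩ := h.support
  obtain ⟨B, hB0, hB⟩ := h.isBumpWeight.bounded
  have hcont : ContinuousOn (fun y : ℝ => ((y : ℝ) : ℂ) ^ (σ : ℂ) * ((eisR ψ₁ y : ℝ) : ℂ)) (Ioi 0) := by
    intro y hy
    have hy' : (0 : ℝ) < y := hy
    exact ((Complex.continuousAt_ofReal_cpow_const y _ (Or.inr hy'.ne')).continuousWithinAt).mul
      (Complex.continuous_ofReal.comp_continuousOn h.continuousOn_eisR y hy)
  -- reduce to `(0, 1/a]`
  refine IntegrableOn.of_forall_sdiff_eq_zero (s := Ioc 0 (1 / a)) ?_ measurableSet_Ioi fun y hy => ?_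
  · have hrpow : IntegrableOn (fun y : ℝ => (4 * B / a) * y ^ σ) (Ioc 0 (1 / a)) :=
      ((intervalIntegral.intervalIntegrable_rpow' hσ (a := 0) (b := 1 / a)).1).const_mul _
    refine hrpow.mono' ((hcont.mono Ioc_subset_Ioi_self).aestronglyMeasurable measurableSet_Ioc) ?_
    filter_upwards [ae_restrict_mem measurableSet_Ioc] with y hy
    rw [norm_mul, Complex.norm_cpow_eq_rpow_re_of_pos hy.1, Complex.ofReal_re, Complex.norm_real, Real.norm_eq_abs,
      mul_comm]
    exact mul_le_mul_of_nonneg_right (abs_eisR_le_const ha (fun t ht => (hsupp t ht).1) hB hy.1) (Real.rpow_nonneg hy.1.le _)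
  · have hy1 : 1 / a < y := by
      rcases not_and_or.mp (fun h' => hy.2 h') with h' | h'
      · exact absurd hy.1 h'
      · exact not_le.mp h'
    rw [eisR_eq_zero_of_lt ha (fun t ht => (hsupp t ht).1) hy1]
    simp

/-- **`∫₀^∞ ψ₂ R_{ψ₁} y⁻² dy = (1/2π) ∫ Φ(5/4 + iτ) dτ`** for smooth bumps with `ψ₁ ≥ 0`: insert the
Mellin inversion of `ψ₂` on `Re = -5/4` and use `∫ y^{s-2}R_{ψ₁} = φ(s)Mψ₁(-s)` on `Re s = 5/4`
(the `φ`-part of (3.12)/(7.12) for `Γ = SL₂(ℤ)`, before the contour shift). [cite: Iwaniec2002, (3.12) & (7.12), PDF pp. 43, 73-74] -/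
theorem integral_inv_sq_mul_eisR_mul_bump (h₁ : IsSmoothBump ψ₁) (h₁0 : ∀ t, 0 ≤ ψ₁ t) (h₂ : IsSmoothBump ψ₂) :
    ∫ y in Ioi (0 : ℝ), ((((y ^ 2)⁻¹ : ℝ) : ℂ) * ((eisR ψ₁ y : ℝ) : ℂ)) * cplx ψ₂ y =
      ((1 / (2 * π) : ℝ) : ℂ) * ∫ τ : ℝ, plPhi ψ₁ ψ₂ (((5 / 4 : ℝ) : ℂ) + τ * Complex.I) := by
  obtain ⟨a, b, ha, hsupp⟩ := h₁.support
  have hGc : ContinuousOn (fun y : ℝ => (((y ^ 2)⁻¹ : ℝ) : ℂ) * ((eisR ψ₁ y : ℝ) : ℂ)) (Ioi 0) := by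
    intro y hy
    have hy' : (0 : ℝ) < y := hy
    exact (Complex.continuous_ofReal.continuousAt.comp ((continuousAt_id.pow 2).inv₀ (by simp [hy'.ne']))).continuousWithinAt.mul
      (Complex.continuous_ofReal.comp_continuousOn h₁.continuousOn_eisR y hy)
  have hpow : ∀ y ∈ Ioi (0 : ℝ), ∀ w : ℂ, (((y ^ 2)⁻¹ : ℝ) : ℂ) * ((y : ℝ) : ℂ) ^ w = ((y : ℝ) : ℂ) ^ (w - 2) := by
    intro y hy w
    have hy' : (0 : ℝ) < y := hy
    have hyc : ((y : ℝ) : ℂ) ≠ 0 := by exact_mod_cast hy'.ne'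
    rw [Complex.cpow_sub _ _ hyc, show ((2 : ℂ)) = ((2 : ℕ) : ℂ) by norm_num, Complex.cpow_natCast]
    push_cast
    field_simp
  have hGi : IntegrableOn (fun y : ℝ => (((y ^ 2)⁻¹ : ℝ) : ℂ) * ((eisR ψ₁ y : ℝ) : ℂ) * ((y : ℝ) : ℂ) ^ (-(((-(5 / 4) : ℝ)) : ℂ))) (Ioi 0) := by
    have h := h₁.integrableOn_rpow_mul_eisR (σ := -(3 / 4)) (by norm_num)
    refine h.congr_fun (fun y hy => ?_) measurableSet_Ioi
    rw [mul_right_comm, hpow y hy]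
    push_cast; ring_nf
  rw [h₂.integral_mul_eq_mellin (-(5 / 4)) hGc hGi]
  -- evaluate the inner integrals
  have hinner : ∀ τ : ℝ, ∫ y in Ioi (0 : ℝ), (((y ^ 2)⁻¹ : ℝ) : ℂ) * ((eisR ψ₁ y : ℝ) : ℂ) *
      ((y : ℝ) : ℂ) ^ (-((((-(5 / 4) : ℝ)) : ℂ) + τ * Complex.I)) =
      scatPhi (((5 / 4 : ℝ) : ℂ) - τ * Complex.I) * mellin (cplx ψ₁) (-(((5 / 4 : ℝ) : ℂ) - τ * Complex.I)) := by
    intro τ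
    rw [← integral_cpow_mul_eisR h₁.smooth.continuous ha hsupp h₁0 (s := ((5 / 4 : ℝ) : ℂ) - τ * Complex.I) (by simp; norm_num)]
    refine setIntegral_congr_fun measurableSet_Ioi fun y hy => ?_
    rw [mul_right_comm, hpow y hy]
    push_cast; ring_nf
  simp_rw [hinner]
  congr 1
  -- `τ ↦ -τ`
  rw [← integral_neg_eq_self]
  refine integral_congr_ae (Eventually.of_forall fun τ => ?_)
  simp only [plPhi]
  have e1 : ((5 / 4 : ℝ) : ℂ) - ((-τ : ℝ) : ℂ) * Complex.I = ((5 / 4 : ℝ) : ℂ) + τ * Complex.I := by push_cast; ring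
  have e2 : (((-(5 / 4) : ℝ)) : ℂ) + ((-τ : ℝ) : ℂ) * Complex.I = -(((5 / 4 : ℝ) : ℂ) + τ * Complex.I) := by push_cast; ring
  rw [e1, e2]
  ring

end T2

/-! ## The contour shift from `Re s = 5/4` to `Re s = ½` -/

section Shift

variable {ψ₁ ψ₂ : ℝ → ℝ}

/-- The regular part `Φ̃(s) = (s-1)Φ(s) = φ̃(s) Mψ₁(-s) Mψ₂(-s)`. [folklore] -/
def plReg (ψ₁ ψ₂ : ℝ → ℝ) (s : ℂ) : ℂ := scatPhiReg s * (mellin (cplx ψ₁) (-s) * mellin (cplx ψ₂) (-s))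

/-- `Φ = Φ̃/(s - 1)`. [folklore] -/
theorem plPhi_eq_div (s : ℂ) : plPhi ψ₁ ψ₂ s = plReg ψ₁ ψ₂ s / (s - 1) := by
  unfold plPhi plReg
  rw [scatPhi_eq_scatPhiReg_div]
  ring

/-- The pole-subtracted integrand `G(s) = [Φ̃(s) - Φ̃(1)]/(s-1) + Φ̃(1)/s = Φ(s) - Φ̃(1)/(s(s-1))`,
holomorphic on the closed strip. [folklore] -/
def plG (ψ₁ ψ₂ : ℝ → ℝ) (s : ℂ) : ℂ := dslope (plReg ψ₁ ψ₂) 1 s + plReg ψ₁ ψ₂ 1 / s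

/-- The auxiliary `B(s) = 1/(s(s-1))` (simple pole at `1` with residue `1`, `O(|s|⁻²)`). [folklore] -/
def plB (s : ℂ) : ℂ := 1 / (s * (s - 1))

/-- `G = Φ - Φ̃(1) B` off `s = 0, 1`. [folklore] -/
theorem plG_eq {s : ℂ} (hs0 : s ≠ 0) (hs1 : s ≠ 1) :
    plG ψ₁ ψ₂ s = plPhi ψ₁ ψ₂ s - plReg ψ₁ ψ₂ 1 * plB s := by
  unfold plG plB
  rw [dslope_of_ne _ hs1, slope_def_field, plPhi_eq_div]
  have hs1' : s - 1 ≠ 0 := sub_ne_zero.mpr hs1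
  field_simp
  ring

/-- `Φ̃` is holomorphic on `Re s ≥ ½`. [folklore] -/
theorem differentiableAt_plReg (h₁ : IsSmoothBump ψ₁) (h₂ : IsSmoothBump ψ₂) {s : ℂ} (hs : 1 / 2 ≤ s.re) :
    DifferentiableAt ℂ (plReg ψ₁ ψ₂) s := by
  unfold plReg
  refine (differentiableAt_scatPhiReg (thetaHat_ne_zero_of_half_le_re hs)).mul ?_
  exact ((h₁.isBumpWeight.differentiable_mellin (-s)).comp s differentiableAt_id.neg).mul
    ((h₂.isBumpWeight.differentiable_mellin (-s)).comp s differentiableAt_id.neg)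

/-- `G` is holomorphic on the closed strip `½ ≤ Re s ≤ 5/4`. [folklore] -/
theorem differentiableOn_plG (h₁ : IsSmoothBump ψ₁) (h₂ : IsSmoothBump ψ₂) :
    DifferentiableOn ℂ (plG ψ₁ ψ₂) (Icc (1 / 2 : ℝ) (5 / 4) ×ℂ univ) := by
  have hreg : DifferentiableOn ℂ (plReg ψ₁ ψ₂) (Icc (1 / 2 : ℝ) (5 / 4) ×ℂ univ) := fun s hs =>
    (differentiableAt_plReg h₁ h₂ (by exact (mem_reProdIm.mp hs).1.1)).differentiableWithinAt
  have hnhds : (Icc (1 / 2 : ℝ) (5 / 4) ×ℂ univ) ∈ 𝓝 (1 : ℂ) := by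
    have hopen : IsOpen (Ioo (1 / 2 : ℝ) (5 / 4) ×ℂ (univ : Set ℝ)) := isOpen_Ioo.reProdIm isOpen_univ
    refine mem_of_superset (hopen.mem_nhds ?_) ?_
    · rw [mem_reProdIm]; norm_num
    · intro s hs
      rw [mem_reProdIm] at hs ⊢
      exact ⟨Ioo_subset_Icc_self hs.1, hs.2⟩
  unfold plG
  refine ((differentiableOn_dslope hnhds).mpr hreg).add ?_
  intro s hs
  have hs0 : s ≠ 0 := by
    intro h; rw [h, mem_reProdIm] at hs; norm_num at hs
  exact ((differentiableAt_const _).div differentiableAt_id hs0).differentiableWithinAt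

/-- `|1/(s(s-1))| ≤ 1/((σ-1)² + τ²)` for `Re s ≥ ½` (`|s| ≥ |s - 1|`). [folklore] -/
theorem norm_plB_le {σ τ : ℝ} (hσ : 1 / 2 ≤ σ) (hne : (σ - 1) ^ 2 + τ ^ 2 ≠ 0) :
    ‖plB (σ + τ * Complex.I)‖ ≤ 1 / ((σ - 1) ^ 2 + τ ^ 2) := by
  unfold plB
  have h1 : ‖(σ : ℂ) + τ * Complex.I - 1‖ ^ 2 = (σ - 1) ^ 2 + τ ^ 2 := by
    rw [show (σ : ℂ) + τ * Complex.I - 1 = ((σ - 1 : ℝ) : ℂ) + τ * Complex.I by push_cast; ring,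
      Complex.sq_norm, Complex.normSq_add_mul_I]
  have h2 : ‖(σ : ℂ) + τ * Complex.I‖ ^ 2 = σ ^ 2 + τ ^ 2 := by
    rw [Complex.sq_norm, Complex.normSq_add_mul_I]
  have hpos : 0 < (σ - 1) ^ 2 + τ ^ 2 := lt_of_le_of_ne (by positivity) (Ne.symm hne)
  have hge : ‖(σ : ℂ) + τ * Complex.I - 1‖ ≤ ‖(σ : ℂ) + τ * Complex.I‖ :=
    (pow_le_pow_iff_left₀ (norm_nonneg _) (norm_nonneg _) two_ne_zero).mp (by rw [h1, h2]; nlinarith)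
  rw [norm_div, norm_one, norm_mul, div_le_div_iff₀ ?_ hpos, one_mul, one_mul, ← h1, sq]
  · exact mul_le_mul_of_nonneg_right hge (norm_nonneg _)
  · have : 0 < ‖(σ : ℂ) + τ * Complex.I - 1‖ := by
      rw [← Real.sqrt_sq (norm_nonneg _), h1]; exact Real.sqrt_pos.mpr hpos
    exact mul_pos (lt_of_lt_of_le this hge) this

/-- **A uniform polynomial bound for `Φ` on the strip**: `|Φ(σ+iτ)| ≤ K/(1+|τ|)²` for
`½ ≤ σ ≤ 5/4` whenever `|τ| ≥ 4` or `|s - 1| ≥ ¼` (the growth of `φ` against the decay of the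
Mellin transforms). [cite: Iwaniec2002, (7.3) & §7.3 ("justified because ... polynomial growth"), PDF pp. 73-74] -/
theorem exists_norm_plPhi_le (h₁ : IsSmoothBump ψ₁) (h₂ : IsSmoothBump ψ₂) :
    ∃ K : ℝ, 0 ≤ K ∧ ∀ σ ∈ Icc (1 / 2 : ℝ) (5 / 4), ∀ τ : ℝ,
      (4 ≤ |τ| ∨ 1 / 4 ≤ ‖(σ : ℂ) + τ * Complex.I - 1‖) →
        ‖plPhi ψ₁ ψ₂ (σ + τ * Complex.I)‖ ≤ K / (1 + |τ|) ^ 2 := by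
  obtain ⟨Cφ, hCφ0, hCφ⟩ := exists_norm_scatPhi_le_on_strip
  obtain ⟨C₁, hC₁0, hC₁⟩ := h₁.exists_norm_mellin_le_pow 13 (-(5 / 4)) (-(1 / 2))
  obtain ⟨C₂, hC₂0, hC₂⟩ := h₂.exists_norm_mellin_le_pow 0 (-(5 / 4)) (-(1 / 2))
  refine ⟨Cφ * C₁ * C₂, by positivity, fun σ hσ τ halt => ?_⟩
  have h1τ : 0 < 1 + |τ| := by positivity
  have hneg : -((σ : ℂ) + τ * Complex.I) = ((-σ : ℝ) : ℂ) + (-τ : ℝ) * Complex.I := by push_cast; ring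
  have hσ' : -σ ∈ Icc (-(5 / 4) : ℝ) (-(1 / 2)) := ⟨by linarith [hσ.2], by linarith [hσ.1]⟩
  have hm1 := hC₁ (-σ) hσ' (-τ)
  have hm2 := hC₂ (-σ) hσ' (-τ)
  rw [abs_neg] at hm1 hm2
  simp only [pow_zero, div_one] at hm2
  have hs1 : (σ : ℂ) + τ * Complex.I ≠ 1 := by
    intro h
    rcases halt with h4 | h4
    · have := congrArg Complex.im h; simp at this; rw [this] at h4; norm_num at h4
    · rw [h, sub_self, norm_zero] at h4; norm_num at h4
  have hφ := hCφ ((σ : ℂ) + τ * Complex.I) (by simp; linarith [hσ.1]) (by simp; linarith [hσ.2]) hs1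
    (by simpa using halt)
  simp only [Complex.add_im, Complex.ofReal_im, Complex.mul_im, Complex.ofReal_re, Complex.I_im, mul_one,
    Complex.I_re, mul_zero, add_zero, zero_add] at hφ
  unfold plPhi
  rw [norm_mul, norm_mul, hneg]
  calc ‖scatPhi ((σ : ℂ) + τ * Complex.I)‖ * (‖mellin (cplx ψ₁) (((-σ : ℝ) : ℂ) + ((-τ : ℝ) : ℂ) * Complex.I)‖ *
        ‖mellin (cplx ψ₂) (((-σ : ℝ) : ℂ) + ((-τ : ℝ) : ℂ) * Complex.I)‖)
      ≤ (Cφ * (1 + |τ|) ^ 11) * (C₁ / (1 + |τ|) ^ 13 * C₂) := by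
        gcongr
    _ = Cφ * C₁ * C₂ / (1 + |τ|) ^ 2 := by
        field_simp

/-- `Φ` restricted to a vertical line `Re = σ ∈ [½, 5/4]` is continuous away from `s = 1`. [folklore] -/
theorem continuous_plPhi_line (h₁ : IsSmoothBump ψ₁) (h₂ : IsSmoothBump ψ₂) {σ : ℝ} (hσ : 1 / 2 ≤ σ) (hσ1 : σ ≠ 1) :
    Continuous fun τ : ℝ => plPhi ψ₁ ψ₂ (σ + τ * Complex.I) := by
  have hline : Continuous fun τ : ℝ => (σ : ℂ) + τ * Complex.I := by fun_prop
  refine continuous_iff_continuousAt.mpr fun τ => ?_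
  have hs1 : (σ : ℂ) + τ * Complex.I ≠ 1 := by
    intro h; have := congrArg Complex.re h; simp at this; exact hσ1 this
  have hd : DifferentiableAt ℂ (plPhi ψ₁ ψ₂) ((σ : ℂ) + τ * Complex.I) := by
    unfold plPhi
    refine (differentiableAt_scatPhi_of_half_le_re (by simpa using hσ) hs1).mul ?_
    exact ((h₁.isBumpWeight.differentiable_mellin _).comp _ differentiableAt_id.neg).mul
      ((h₂.isBumpWeight.differentiable_mellin _).comp _ differentiableAt_id.neg)
  exact hd.continuousAt.comp (f := fun τ : ℝ => (σ : ℂ) + τ * Complex.I) hline.continuousAt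

/-- `Φ` is integrable on the lines `Re s = ½` and `Re s = 5/4`. [folklore] -/
theorem integrable_plPhi_line (h₁ : IsSmoothBump ψ₁) (h₂ : IsSmoothBump ψ₂) {σ : ℝ} (hσ : σ = 1 / 2 ∨ σ = 5 / 4) :
    Integrable fun τ : ℝ => plPhi ψ₁ ψ₂ (σ + τ * Complex.I) := by
  obtain ⟨K, hK0, hK⟩ := exists_norm_plPhi_le h₁ h₂
  have hσmem : σ ∈ Icc (1 / 2 : ℝ) (5 / 4) := by rcases hσ with rfl | rfl <;> norm_num
  have hσ1 : σ ≠ 1 := by rcases hσ with rfl | rfl <;> norm_num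
  have hfar : ∀ τ : ℝ, 1 / 4 ≤ ‖(σ : ℂ) + τ * Complex.I - 1‖ := by
    intro τ
    have h1 : |σ - 1| ≤ ‖(σ : ℂ) + τ * Complex.I - 1‖ := by
      calc |σ - 1| = |((σ : ℂ) + τ * Complex.I - 1).re| := by simp
        _ ≤ ‖(σ : ℂ) + τ * Complex.I - 1‖ := Complex.abs_re_le_norm _
    refine le_trans ?_ h1
    rcases hσ with h | h <;> (rw [h]; norm_num [abs_of_neg, abs_of_pos])
  refine Integrable.mono' ((integrable_inv_one_add_sq).const_mul K) (continuous_plPhi_line h₁ h₂ hσmem.1 hσ1).aestronglyMeasurable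
    (Eventually.of_forall fun τ => ?_)
  calc ‖plPhi ψ₁ ψ₂ (σ + τ * Complex.I)‖ ≤ K / (1 + |τ|) ^ 2 := hK σ hσmem τ (Or.inr (hfar τ))
    _ ≤ K * (1 + τ ^ 2)⁻¹ := by
        rw [div_eq_mul_inv]; gcongr; nlinarith [abs_nonneg τ, sq_abs τ]

/-- `B` is integrable on every line `Re s = σ ≥ ½`, `σ ≠ 1`. [folklore] -/
theorem integrable_plB_line {σ : ℝ} (hσ : 1 / 2 ≤ σ) (hσ1 : σ ≠ 1) :
    Integrable fun τ : ℝ => plB (σ + τ * Complex.I) := by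
  have hδ : 0 < (σ - 1) ^ 2 := by positivity
  have hcont : Continuous fun τ : ℝ => plB (σ + τ * Complex.I) := by
    unfold plB
    refine Continuous.div continuous_const (by fun_prop) fun τ => ?_
    refine mul_ne_zero ?_ ?_
    · intro h; have := congrArg Complex.re h; simp at this; linarith
    · intro h; have := congrArg Complex.re h; simp at this; exact hσ1 (by linarith)
  -- dominate by `((σ-1)² )⁻¹ · (1 + (τ/|σ-1|)²)⁻¹`-type function: use `1/((σ-1)²+τ²) ≤ max(1,(σ-1)⁻²)/(1+τ²)`
  set c : ℝ := max 1 ((σ - 1) ^ 2)⁻¹ with hc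
  refine Integrable.mono' ((integrable_inv_one_add_sq).const_mul c) hcont.aestronglyMeasurable
    (Eventually.of_forall fun τ => ?_)
  have hne : (σ - 1) ^ 2 + τ ^ 2 ≠ 0 := by positivity
  refine (norm_plB_le hσ hne).trans ?_
  have hpos : 0 < (σ - 1) ^ 2 + τ ^ 2 := by positivity
  have h1 : 1 ≤ c * ((σ - 1) ^ 2) := by
    calc (1 : ℝ) = ((σ - 1) ^ 2)⁻¹ * (σ - 1) ^ 2 := by field_simp
      _ ≤ c * (σ - 1) ^ 2 := by gcongr; exact le_max_right _ _
  have h2 : 1 ≤ c := le_max_left _ _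
  rw [← div_eq_mul_inv, div_le_div_iff₀ hpos (by positivity)]
  nlinarith [h1, h2, sq_nonneg τ, mul_nonneg (sub_nonneg.mpr h2) (sq_nonneg τ)]

/-- **`∫ B(½ + iτ) dτ = -2π`** (`B(½+iτ) = -1/(¼ + τ²)`). [folklore] -/
theorem integral_plB_half : ∫ τ : ℝ, plB (((1 / 2 : ℝ) : ℂ) + τ * Complex.I) = -2 * π := by
  have e : ∀ τ : ℝ, plB (((1 / 2 : ℝ) : ℂ) + τ * Complex.I) = ((-(1 / 4 + τ ^ 2)⁻¹ : ℝ) : ℂ) := by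
    intro τ
    unfold plB
    have h : (((1 / 2 : ℝ) : ℂ) + τ * Complex.I) * (((1 / 2 : ℝ) : ℂ) + τ * Complex.I - 1) = ((-(1 / 4 + τ ^ 2) : ℝ) : ℂ) := by
      push_cast
      ring_nf
      rw [Complex.I_sq]
      ring
    rw [h]
    have hne : (1 / 4 + τ ^ 2 : ℝ) ≠ 0 := by positivity
    push_cast
    field_simp
  simp_rw [e]
  rw [integral_complex_ofReal]
  have h2 : ∫ τ : ℝ, -(1 / 4 + τ ^ 2)⁻¹ = -(2 * π) := by
    rw [integral_neg]
    congr 1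
    have e2 : (fun τ : ℝ => (1 / 4 + τ ^ 2)⁻¹) = fun τ => (fun u : ℝ => 4 * (1 + u ^ 2)⁻¹) (2 * τ) := by
      funext τ
      have : (1 + (2 * τ) ^ 2 : ℝ) ≠ 0 := by positivity
      field_simp
      ring
    rw [e2, Measure.integral_comp_mul_left (fun u : ℝ => 4 * (1 + u ^ 2)⁻¹) (2 : ℝ), integral_const_mul,
      integral_univ_inv_one_add_sq]
    norm_num [abs_of_pos]
    ring
  rw [h2]
  push_cast
  ring

/-- **`∫ B(5/4 + iτ) dτ = 0`**: `B(s) = d/ds [log(1 - 1/s)]` with `1 - 1/s` in the right half-plane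
on `Re s = 5/4`, and `log(1 - 1/s) → 0` at both ends. [folklore] -/
theorem integral_plB_five_fourths : ∫ τ : ℝ, plB (((5 / 4 : ℝ) : ℂ) + τ * Complex.I) = 0 := by
  set h : ℝ → ℂ := fun τ => ((5 / 4 : ℝ) : ℂ) + τ * Complex.I with hh
  have hh_ne : ∀ τ, h τ ≠ 0 := fun τ => by
    intro h0; have := congrArg Complex.re h0; norm_num [hh] at this
  have hh_norm : ∀ τ, |τ| ≤ ‖h τ‖ := fun τ => by
    calc |τ| = |(h τ).im| := by simp [hh]
      _ ≤ ‖h τ‖ := Complex.abs_im_le_norm _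
  set g : ℝ → ℂ := fun τ => 1 - (h τ)⁻¹ with hg
  have hg_re : ∀ τ, 0 < (g τ).re := by
    intro τ
    simp only [hg, hh, Complex.sub_re, Complex.one_re, Complex.inv_re]
    have hns : Complex.normSq (((5 / 4 : ℝ) : ℂ) + τ * Complex.I) = (5 / 4) ^ 2 + τ ^ 2 := by
      rw [Complex.normSq_add_mul_I]
    rw [hns]
    simp only [Complex.add_re, Complex.ofReal_re, Complex.mul_re, Complex.I_re, mul_zero, Complex.ofReal_im,
      Complex.I_im, mul_one, sub_self, add_zero]
    rw [sub_pos, div_lt_one (by positivity)]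
    nlinarith [sq_nonneg τ]
  have hg_slit : ∀ τ, g τ ∈ Complex.slitPlane := fun τ => Complex.mem_slitPlane_iff.mpr (Or.inl (hg_re τ))
  set f : ℝ → ℂ := fun τ => -Complex.I * Complex.log (g τ) with hf
  -- derivative
  have hderiv : ∀ τ, HasDerivAt f (plB (h τ)) τ := by
    intro τ
    have h1 : HasDerivAt h Complex.I τ := by
      have := ((hasDerivAt_id τ).ofReal_comp.mul_const Complex.I).const_add (((5 / 4 : ℝ) : ℂ))
      simpa [hh] using this
    have h2 : HasDerivAt (fun t => (h t)⁻¹) (-((h τ) ^ 2)⁻¹ * Complex.I) τ :=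
      (hasDerivAt_inv (hh_ne τ)).comp τ h1
    have h3 : HasDerivAt g (-(-((h τ) ^ 2)⁻¹ * Complex.I)) τ := h2.const_sub 1
    have h4 : HasDerivAt (fun t => Complex.log (g t)) ((g τ)⁻¹ * -(-((h τ) ^ 2)⁻¹ * Complex.I)) τ :=
      (Complex.hasDerivAt_log (hg_slit τ)).comp τ h3
    have h5 := h4.const_mul (-Complex.I)
    refine h5.congr_deriv ?_
    have hgne : g τ ≠ 0 := fun h0 => by have := hg_re τ; rw [h0] at this; simp at this
    have hhne := hh_ne τ
    have hg' : g τ = (h τ - 1) / h τ := by simp only [hg]; field_simp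
    unfold plB
    rw [hg'] at hgne ⊢
    have h1ne : h τ - 1 ≠ 0 := by
      intro h0; apply hgne; rw [h0, zero_div]
    field_simp
    rw [Complex.I_sq]
    ring
  -- limits at `±∞`
  have hinv0 : Tendsto (fun τ => (h τ)⁻¹) atTop (𝓝 0) := by
    refine squeeze_zero_norm' ?_ tendsto_inv_atTop_zero
    filter_upwards [eventually_gt_atTop (0 : ℝ)] with τ hτ
    rw [norm_inv]
    calc ‖h τ‖⁻¹ ≤ |τ|⁻¹ := inv_anti₀ (abs_pos.mpr hτ.ne') (hh_norm τ)
      _ = τ⁻¹ := by rw [abs_of_pos hτ]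
  have hinv0' : Tendsto (fun τ => (h τ)⁻¹) atBot (𝓝 0) := by
    refine squeeze_zero_norm' ?_ (tendsto_inv_atTop_zero.comp tendsto_neg_atBot_atTop)
    filter_upwards [eventually_lt_atBot (0 : ℝ)] with τ hτ
    rw [norm_inv, Function.comp_apply]
    calc ‖h τ‖⁻¹ ≤ |τ|⁻¹ := inv_anti₀ (abs_pos.mpr hτ.ne) (hh_norm τ)
      _ = (-τ)⁻¹ := by rw [abs_of_neg hτ]
  have hlog1 : ContinuousAt Complex.log 1 := continuousAt_clog (Complex.mem_slitPlane_iff.mpr (Or.inl (by norm_num)))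
  have hlim : ∀ l : Filter ℝ, Tendsto (fun τ => (h τ)⁻¹) l (𝓝 0) → Tendsto f l (𝓝 0) := by
    intro l hl
    have hg1 : Tendsto g l (𝓝 1) := by
      have := (tendsto_const_nhds (x := (1 : ℂ))).sub hl
      simpa [hg] using this
    have hlg : Tendsto (fun τ => Complex.log (g τ)) l (𝓝 0) := by
      have := hlog1.tendsto.comp hg1
      rwa [Complex.log_one] at this
    have := hlg.const_mul (-Complex.I)
    simpa [hf] using this
  have hint : Integrable fun τ : ℝ => plB (h τ) := integrable_plB_line (σ := 5 / 4) (by norm_num) (by norm_num)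
  have := integral_of_hasDerivAt_of_tendsto hderiv hint (hlim _ hinv0') (hlim _ hinv0)
  simpa [hh] using this

/-- **The contour shift (3.12) → (7.12) for the modular group**:
`∫ Φ(5/4+iτ) dτ = ∫ Φ(½+iτ) dτ + 2π Φ̃(1)`, `Φ̃(1) = (3/π) Mψ₁(-1) Mψ₂(-1)` the residue at the
pole `s = 1` of `φ`. Cauchy's theorem for `G = Φ - Φ̃(1)B` on `[½, 5/4] × [-T, T]`, `T → ∞`
(`G` is holomorphic on the closed strip and `→ 0` uniformly by the polynomial growth of `φ` and the
decay of the Mellin transforms), and the two explicit integrals of `B`. [cite: Iwaniec2002, (3.12) & (7.12), PDF pp. 43, 73-74] -/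
theorem integral_plPhi_shift (h₁ : IsSmoothBump ψ₁) (h₂ : IsSmoothBump ψ₂) :
    ∫ τ : ℝ, plPhi ψ₁ ψ₂ (((5 / 4 : ℝ) : ℂ) + τ * Complex.I) =
      (∫ τ : ℝ, plPhi ψ₁ ψ₂ (((1 / 2 : ℝ) : ℂ) + τ * Complex.I)) + 2 * π * plReg ψ₁ ψ₂ 1 := by
  set A : ℂ := plReg ψ₁ ψ₂ 1 with hA
  obtain ⟨K, hK0, hK⟩ := exists_norm_plPhi_le h₁ h₂
  -- `G = Φ - A B` on the two lines
  have hlines : ∀ σ : ℝ, (σ = 1 / 2 ∨ σ = 5 / 4) → ∀ τ : ℝ,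
      plG ψ₁ ψ₂ ((σ : ℂ) + τ * Complex.I) = plPhi ψ₁ ψ₂ ((σ : ℂ) + τ * Complex.I) - A * plB ((σ : ℂ) + τ * Complex.I) := by
    intro σ hσ τ
    refine plG_eq ?_ ?_
    · intro h; have := congrArg Complex.re h; simp at this; rcases hσ with h' | h' <;> (rw [h'] at this; norm_num at this)
    · intro h; have := congrArg Complex.re h; simp at this; rcases hσ with h' | h' <;> (rw [h'] at this; norm_num at this)
  have hint : ∀ σ : ℝ, (σ = 1 / 2 ∨ σ = 5 / 4) → Integrable fun τ : ℝ => plG ψ₁ ψ₂ ((σ : ℂ) + τ * Complex.I) := by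
    intro σ hσ
    have hσ' : 1 / 2 ≤ σ := by rcases hσ with rfl | rfl <;> norm_num
    have hσ1 : σ ≠ 1 := by rcases hσ with rfl | rfl <;> norm_num
    have := (integrable_plPhi_line h₁ h₂ hσ).sub ((integrable_plB_line hσ' hσ1).const_mul A)
    exact this.congr (Eventually.of_forall fun τ => (hlines σ hσ τ).symm)
  -- uniform decay on the strip
  have hdecay : ∀ ε : ℝ, 0 < ε → ∃ T₀ : ℝ, ∀ σ ∈ Icc (1 / 2 : ℝ) (5 / 4), ∀ T : ℝ, T₀ ≤ |T| →
      ‖plG ψ₁ ψ₂ (σ + T * Complex.I)‖ ≤ ε := by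
    intro ε hε
    refine ⟨max 4 ((K + ‖A‖) / ε + 1), fun σ hσ T hT => ?_⟩
    have hT4 : 4 ≤ |T| := le_trans (le_max_left _ _) hT
    have hTpos : 0 < |T| := by linarith
    have hs0 : (σ : ℂ) + T * Complex.I ≠ 0 := by
      intro h; have := congrArg Complex.im h; simp at this; rw [this] at hT4; norm_num at hT4
    have hs1 : (σ : ℂ) + T * Complex.I ≠ 1 := by
      intro h; have := congrArg Complex.im h; simp at this; rw [this] at hT4; norm_num at hT4
    rw [plG_eq hs0 hs1]
    have hΦ : ‖plPhi ψ₁ ψ₂ (σ + T * Complex.I)‖ ≤ K / |T| := by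
      refine (hK σ hσ T (Or.inl hT4)).trans ?_
      rw [div_le_div_iff₀ (by positivity) hTpos]
      exact mul_le_mul_of_nonneg_left (by nlinarith [abs_nonneg T]) hK0
    have hB : ‖A * plB (σ + T * Complex.I)‖ ≤ ‖A‖ / |T| := by
      rw [norm_mul]
      have hT2 : 0 < T ^ 2 := by have := pow_pos hTpos 2; rwa [sq_abs] at this
      have hne : (σ - 1) ^ 2 + T ^ 2 ≠ 0 := ne_of_gt (by nlinarith [sq_nonneg (σ - 1)])
      have h1 := norm_plB_le hσ.1 hne
      have h2 : 1 / ((σ - 1) ^ 2 + T ^ 2) ≤ 1 / |T| := by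
        rw [div_le_div_iff₀ (by positivity) hTpos]
        nlinarith [sq_abs T, sq_nonneg (σ - 1), abs_nonneg T]
      calc ‖A‖ * ‖plB (σ + T * Complex.I)‖ ≤ ‖A‖ * (1 / |T|) := mul_le_mul_of_nonneg_left (h1.trans h2) (norm_nonneg _)
        _ = ‖A‖ / |T| := by ring
    have hTge : (K + ‖A‖) / ε + 1 ≤ |T| := le_trans (le_max_right _ _) hT
    calc ‖plPhi ψ₁ ψ₂ (σ + T * Complex.I) - A * plB (σ + T * Complex.I)‖
        ≤ K / |T| + ‖A‖ / |T| := (norm_sub_le _ _).trans (add_le_add hΦ hB)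
      _ = (K + ‖A‖) / |T| := by ring
      _ ≤ ε := by
          rw [div_le_iff₀ hTpos]
          have : (K + ‖A‖) / ε ≤ |T| := by linarith
          rw [div_le_iff₀ hε] at this
          linarith [mul_comm ε |T|]
  have hV := Literature.NumberTheory.LFunctions.MertensBoundRH.integral_vertical_eq_of_tendsto (plG ψ₁ ψ₂)
    (by norm_num : (1 / 2 : ℝ) ≤ 5 / 4) (differentiableOn_plG h₁ h₂) (hint _ (Or.inl rfl)) (hint _ (Or.inr rfl)) hdecay
  -- expand both sides
  have hexp : ∀ σ : ℝ, (σ = 1 / 2 ∨ σ = 5 / 4) →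
      ∫ τ : ℝ, plG ψ₁ ψ₂ ((σ : ℂ) + τ * Complex.I) =
        (∫ τ : ℝ, plPhi ψ₁ ψ₂ ((σ : ℂ) + τ * Complex.I)) - A * ∫ τ : ℝ, plB ((σ : ℂ) + τ * Complex.I) := by
    intro σ hσ
    have hσ' : 1 / 2 ≤ σ := by rcases hσ with rfl | rfl <;> norm_num
    have hσ1 : σ ≠ 1 := by rcases hσ with rfl | rfl <;> norm_num
    rw [integral_congr_ae (Eventually.of_forall (hlines σ hσ)), integral_sub (integrable_plPhi_line h₁ h₂ hσ)
      ((integrable_plB_line hσ' hσ1).const_mul A), integral_const_mul]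
  rw [hexp _ (Or.inl rfl), hexp _ (Or.inr rfl), integral_plB_half, integral_plB_five_fourths] at hV
  linear_combination -hV

/-- `Φ̃(1) = (3/π) Mψ₁(-1) Mψ₂(-1)` (the residue term). [cite: Iwaniec2002, (7.12) & (6.33), PDF pp. 90, 74] -/
theorem plReg_one (ψ₁ ψ₂ : ℝ → ℝ) : plReg ψ₁ ψ₂ 1 = 3 / π * (mellin (cplx ψ₁) (-1) * mellin (cplx ψ₂) (-1)) := by
  unfold plReg
  rw [scatPhiReg_one]

end Shift


/-! ## Plancherel for incomplete Eisenstein series (Iwaniec, Theorem 7.3 for `SL₂(ℤ)`) -/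

section Plancherel

variable {ψ ψ₁ ψ₂ : ℝ → ℝ}

/-- `m_ψ(τ) = Mψ(-½ - iτ)`. [folklore] -/
def mLine (ψ : ℝ → ℝ) (τ : ℝ) : ℂ := mellin (cplx ψ) (((-(1 / 2) : ℝ) : ℂ) - τ * Complex.I)

/-- `conj m_ψ(τ) = Mψ(-½ + iτ)`. [folklore] -/
theorem conj_mLine (ψ : ℝ → ℝ) (τ : ℝ) : conj (mLine ψ τ) = mellin (cplx ψ) (((-(1 / 2) : ℝ) : ℂ) + τ * Complex.I) := by
  unfold mLine
  rw [← mellin_cplx_conj]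
  congr 1
  simp only [map_sub, map_mul, Complex.conj_ofReal, Complex.conj_I]
  ring

/-- `s(τ) = ½ + iτ` in the `σ + τI` format. [folklore] -/
theorem critS_eq' (τ : ℝ) : critS τ = ((1 / 2 : ℝ) : ℂ) + τ * Complex.I := by
  unfold critS; push_cast; ring

/-- `s(-r) - 1 = -½ - ir` and `s(r) - 1 = conj(-½ - ir)`. [folklore] -/
theorem critS_neg_sub_one (r : ℝ) : critS (-r) - 1 = ((-(1 / 2) : ℝ) : ℂ) - r * Complex.I := by
  unfold critS; push_cast; ring

/-- `s(r) - 1 = -½ + ir`. [folklore] -/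
theorem critS_sub_one (r : ℝ) : critS r - 1 = ((-(1 / 2) : ℝ) : ℂ) + r * Complex.I := by
  unfold critS; push_cast; ring

/-- `-s(τ) = -½ - iτ`. [folklore] -/
theorem neg_critS (τ : ℝ) : -critS τ = ((-(1 / 2) : ℝ) : ℂ) - τ * Complex.I := by
  unfold critS; push_cast; ring

/-- **`ℰ_ψ(r) = 2[m_ψ(r) + conj φ(½+ir) · conj m_ψ(r)]`.** [cite: Iwaniec2002, §7.3 (before (7.14)), PDF p. 74] -/
theorem eisCoeff_eq_mLine (hψ : IsBumpWeight ψ) (r : ℝ) :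
    eisCoeff ψ r = 2 * (mLine ψ r + conj (scatPhi (critS r)) * conj (mLine ψ r)) := by
  rw [eisCoeff_eq hψ, critS_neg_sub_one, critS_sub_one, conj_mLine]
  rfl

/-- `τ ↦ m_ψ(τ)` is continuous. [folklore] -/
theorem continuous_mLine (hψ : IsBumpWeight ψ) : Continuous (mLine ψ) := by
  unfold mLine
  exact hψ.differentiable_mellin.continuous.comp (by fun_prop)

/-- `τ ↦ φ(½ + iτ)` is continuous (no pole on the critical line). [folklore] -/
theorem continuous_scatPhi_critS : Continuous fun τ : ℝ => scatPhi (critS τ) := by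
  refine continuous_iff_continuousAt.mpr fun τ => ?_
  have hd := differentiableAt_scatPhi_of_half_le_re (s := critS τ) (by simp [critS]) (critS_ne_one τ)
  exact hd.continuousAt.comp (f := critS) continuous_critS.continuousAt

/-- The spectral integrand `X(τ) = m₁ conj m₂ + φ(½+iτ) m₁ m₂`. [folklore] -/
def plX (ψ₁ ψ₂ : ℝ → ℝ) (τ : ℝ) : ℂ :=
  mLine ψ₁ τ * conj (mLine ψ₂ τ) + scatPhi (critS τ) * (mLine ψ₁ τ * mLine ψ₂ τ)

/-- `Φ(½ + iτ) = φ(½+iτ) m₁(τ) m₂(τ)`. [folklore] -/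
theorem plPhi_half (ψ₁ ψ₂ : ℝ → ℝ) (τ : ℝ) :
    plPhi ψ₁ ψ₂ (((1 / 2 : ℝ) : ℂ) + τ * Complex.I) = scatPhi (critS τ) * (mLine ψ₁ τ * mLine ψ₂ τ) := by
  unfold plPhi mLine
  rw [← critS_eq', neg_critS]

/-- **`ℰ_{ψ₁}(r) conj ℰ_{ψ₂}(r) = 4[X(r) + conj X(r)]`** (`|φ(½+ir)| = 1`). [folklore] -/
theorem eisCoeff_mul_conj_eisCoeff (hψ₁ : IsBumpWeight ψ₁) (hψ₂ : IsBumpWeight ψ₂) (r : ℝ) :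
    eisCoeff ψ₁ r * conj (eisCoeff ψ₂ r) = 4 * (plX ψ₁ ψ₂ r + conj (plX ψ₁ ψ₂ r)) := by
  have hφ : scatPhi (critS r) * conj (scatPhi (critS r)) = 1 := by
    rw [Complex.mul_conj, Complex.normSq_eq_norm_sq, norm_scatPhi_critS]; simp
  have h2 : conj (2 : ℂ) = 2 := map_ofNat _ 2
  rw [eisCoeff_eq_mLine hψ₁, eisCoeff_eq_mLine hψ₂]
  unfold plX
  simp only [map_mul, map_add, Complex.conj_conj, h2]
  linear_combination (4 * conj (mLine ψ₁ r) * mLine ψ₂ r) * hφ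

/-- `X` is integrable (`|X| ≤ 2|m₁||m₂|` and the Mellin decay). [folklore] -/
theorem integrable_plX (h₁ : IsSmoothBump ψ₁) (h₂ : IsSmoothBump ψ₂) : Integrable (plX ψ₁ ψ₂) := by
  obtain ⟨C₁, hC₁0, hC₁⟩ := h₁.exists_norm_mellin_le_pow 2 (-(1 / 2)) (-(1 / 2))
  obtain ⟨C₂, hC₂0, hC₂⟩ := h₂.exists_norm_mellin_le_pow 0 (-(1 / 2)) (-(1 / 2))
  have hcont : Continuous (plX ψ₁ ψ₂) := by
    unfold plX
    exact ((continuous_mLine h₁.isBumpWeight).mul (Complex.continuous_conj.comp (continuous_mLine h₂.isBumpWeight))).add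
      (continuous_scatPhi_critS.mul ((continuous_mLine h₁.isBumpWeight).mul (continuous_mLine h₂.isBumpWeight)))
  refine Integrable.mono' ((integrable_inv_one_add_sq).const_mul (2 * C₁ * C₂)) hcont.aestronglyMeasurable
    (Eventually.of_forall fun τ => ?_)
  have hm1 : ‖mLine ψ₁ τ‖ ≤ C₁ / (1 + |τ|) ^ 2 := by
    have := hC₁ (-(1 / 2)) ⟨le_rfl, le_rfl⟩ (-τ)
    rw [abs_neg] at this
    unfold mLine
    convert this using 2; push_cast; ring
  have hm2 : ‖mLine ψ₂ τ‖ ≤ C₂ := by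
    have := hC₂ (-(1 / 2)) ⟨le_rfl, le_rfl⟩ (-τ)
    simp only [pow_zero, div_one] at this
    unfold mLine
    convert this using 2; push_cast; ring
  have h1τ : 0 < 1 + |τ| := by positivity
  unfold plX
  calc ‖mLine ψ₁ τ * conj (mLine ψ₂ τ) + scatPhi (critS τ) * (mLine ψ₁ τ * mLine ψ₂ τ)‖
      ≤ ‖mLine ψ₁ τ‖ * ‖mLine ψ₂ τ‖ + 1 * (‖mLine ψ₁ τ‖ * ‖mLine ψ₂ τ‖) := by
        refine (norm_add_le _ _).trans (add_le_add ?_ ?_)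
        · rw [norm_mul, Complex.norm_conj]
        · rw [norm_mul, norm_mul, norm_scatPhi_critS]
    _ = 2 * (‖mLine ψ₁ τ‖ * ‖mLine ψ₂ τ‖) := by ring
    _ ≤ 2 * (C₁ / (1 + |τ|) ^ 2 * C₂) := by gcongr
    _ ≤ 2 * C₁ * C₂ * (1 + τ ^ 2)⁻¹ := by
        rw [show 2 * (C₁ / (1 + |τ|) ^ 2 * C₂) = 2 * C₁ * C₂ * ((1 + |τ|) ^ 2)⁻¹ by ring]
        gcongr
        nlinarith [abs_nonneg τ, sq_abs τ]

/-- The diagonal part `m₁ conj m₂` is integrable. [folklore] -/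
theorem integrable_mLine_mul_conj (h₁ : IsSmoothBump ψ₁) (h₂ : IsSmoothBump ψ₂) :
    Integrable fun τ : ℝ => mLine ψ₁ τ * conj (mLine ψ₂ τ) := by
  have hX := integrable_plX h₁ h₂
  have hΦ : Integrable fun τ : ℝ => scatPhi (critS τ) * (mLine ψ₁ τ * mLine ψ₂ τ) := by
    have := integrable_plPhi_line h₁ h₂ (σ := 1 / 2) (Or.inl rfl)
    simpa only [plPhi_half] using this
  have := hX.sub hΦ
  refine this.congr (Eventually.of_forall fun τ => ?_)
  simp [plX]

/-- `ℰ_ψ` is continuous in `r`. [folklore] -/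
theorem continuous_eisCoeff (hψ : IsBumpWeight ψ) : Continuous (eisCoeff ψ) := by
  have e : eisCoeff ψ = fun r => 2 * (mLine ψ r + conj (scatPhi (critS r)) * conj (mLine ψ r)) :=
    funext fun r => eisCoeff_eq_mLine hψ r
  rw [e]
  exact continuous_const.mul ((continuous_mLine hψ).add
    ((Complex.continuous_conj.comp continuous_scatPhi_critS).mul (Complex.continuous_conj.comp (continuous_mLine hψ))))

/-- **Decay of the Eisenstein coefficient**: `|ℰ_ψ(r)| ≤ C(1 + |r|)^{-k}` for every `k` (smooth `ψ`).
[cite: Iwaniec2002, (3.13) & (7.3), PDF pp. 43, 73-74] -/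
theorem IsSmoothBump.exists_norm_eisCoeff_le (h : IsSmoothBump ψ) (k : ℕ) :
    ∃ C : ℝ, 0 ≤ C ∧ ∀ r : ℝ, ‖eisCoeff ψ r‖ ≤ C / (1 + |r|) ^ k := by
  obtain ⟨C, hC0, hC⟩ := h.exists_norm_mellin_le_pow k (-(1 / 2)) (-(1 / 2))
  refine ⟨4 * C, by positivity, fun r => ?_⟩
  have hm : ‖mLine ψ r‖ ≤ C / (1 + |r|) ^ k := by
    have := hC (-(1 / 2)) ⟨le_rfl, le_rfl⟩ (-r)
    rw [abs_neg] at this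
    unfold mLine
    convert this using 2; push_cast; ring
  rw [eisCoeff_eq_mLine h.isBumpWeight, norm_mul, Complex.norm_two]
  calc 2 * ‖mLine ψ r + conj (scatPhi (critS r)) * conj (mLine ψ r)‖
      ≤ 2 * (‖mLine ψ r‖ + 1 * ‖mLine ψ r‖) := by
        gcongr
        refine (norm_add_le _ _).trans (add_le_add le_rfl ?_)
        rw [norm_mul, Complex.norm_conj, Complex.norm_conj, norm_scatPhi_critS]
    _ = 4 * ‖mLine ψ r‖ := by ring
    _ ≤ 4 * (C / (1 + |r|) ^ k) := by gcongr
    _ = 4 * C / (1 + |r|) ^ k := by ring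

/-- `ℰ_{ψ₁} conj ℰ_{ψ₂}` is integrable. [folklore] -/
theorem integrable_eisCoeff_mul_conj (h₁ : IsSmoothBump ψ₁) (h₂ : IsSmoothBump ψ₂) :
    Integrable fun r : ℝ => eisCoeff ψ₁ r * conj (eisCoeff ψ₂ r) := by
  have hX := integrable_plX h₁ h₂
  have hXconj : Integrable fun τ : ℝ => conj (plX ψ₁ ψ₂ τ) :=
    hX.norm.mono' (Complex.continuous_conj.comp_aestronglyMeasurable hX.aestronglyMeasurable)
      (Eventually.of_forall fun τ => by rw [Complex.norm_conj])
  have := (hX.add hXconj).const_mul 4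
  exact this.congr (Eventually.of_forall fun r => (eisCoeff_mul_conj_eisCoeff h₁.isBumpWeight h₂.isBumpWeight r).symm)

/-- `ℰ_ψ ∈ L²(ℝ)` (indeed in every `L^p`). [cite: Iwaniec2002, Prop. 7.1 & Cor., PDF p. 70] -/
theorem IsSmoothBump.memLp_eisCoeff (h : IsSmoothBump ψ) : MemLp (eisCoeff ψ) 2 (volume : Measure ℝ) := by
  obtain ⟨C, hC0, hC⟩ := h.exists_norm_eisCoeff_le 1
  have hcont := continuous_eisCoeff h.isBumpWeight
  refine (memLp_two_iff_integrable_sq_norm hcont.aestronglyMeasurable).mpr ?_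
  refine Integrable.mono' ((integrable_inv_one_add_sq).const_mul (C ^ 2)) (hcont.norm.pow 2).aestronglyMeasurable
    (Eventually.of_forall fun r => ?_)
  rw [Real.norm_eq_abs, abs_of_nonneg (by positivity)]
  have h1 : 0 < 1 + |r| := by positivity
  calc ‖eisCoeff ψ r‖ ^ 2 ≤ (C / (1 + |r|) ^ 1) ^ 2 := by gcongr; exact hC r
    _ = C ^ 2 * ((1 + |r|) ^ 2)⁻¹ := by rw [pow_one]; field_simp
    _ ≤ C ^ 2 * (1 + r ^ 2)⁻¹ := by gcongr; nlinarith [abs_nonneg r, sq_abs r]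

/-- **Plancherel for incomplete Eisenstein series of `SL₂(ℤ)` (Iwaniec (7.12) in inner-product form).**
For smooth bumps `ψ₁ ≥ 0`, `ψ₂` on `(0, ∞)`,

  `∫_𝒟 E(·|ψ₁) E(·|ψ₂) dμ = 4·(3/π) Mψ₁(-1) Mψ₂(-1) + (1/4π) ∫_ℝ ℰ_{ψ₁}(r) conj ℰ_{ψ₂}(r) dr`,

where `2Mψ(-1) = ⟨E(·|ψ), 1⟩`, so the first term is `⟨E(·|ψ₁), u₀⟩⟨u₀, E(·|ψ₂)⟩` with `u₀ = (3/π)^{½}`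
((3.26)), and `ℰ_ψ(r) = ⟨E(·|ψ), E(·, ½+ir)⟩` (`eisCoeff`): the incomplete Eisenstein series decompose
over the constant function and the Eisenstein eigenpacket with Plancherel measure `dr/4π`. Proof:
unfold (`⟨E₁,E₂⟩ = 2∫y⁻²ψ₂(2ψ₁ + 2R₁)`), Mellin–Plancherel for `∫ψ₁ψ₂y⁻²`, Mellin inversion and
`∫y^{s-2}R₁ = φ(s)Mψ₁(-s)` for `∫ψ₂R₁y⁻²` on `Re s = 5/4`, shift to `Re s = ½` across the pole of
`φ` at `s = 1` (residue `3/π`), and `|φ(½+ir)| = 1` to complete the square.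
[cite: Iwaniec2002, Thm 7.3 & (7.12)-(7.15), PDF pp. 73-75] -/
theorem integral_fd_incEisG_mul_incEisG_eq_spectral (h₁ : IsSmoothBump ψ₁) (h₁0 : ∀ t, 0 ≤ ψ₁ t)
    (h₂ : IsSmoothBump ψ₂) :
    ∫ w in ModularGroup.fd, ((incEisG ψ₁ w : ℝ) : ℂ) * ((incEisG ψ₂ w : ℝ) : ℂ) =
      4 * (3 / π * (mellin (cplx ψ₁) (-1) * mellin (cplx ψ₂) (-1))) +
        ((1 / (4 * π) : ℝ) : ℂ) * ∫ r : ℝ, eisCoeff ψ₁ r * conj (eisCoeff ψ₂ r) := by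
  have hπ0 : (π : ℂ) ≠ 0 := by exact_mod_cast Real.pi_pos.ne'
  set c : ℂ := ((1 / (2 * π) : ℝ) : ℂ) with hc
  set L := ∫ w in ModularGroup.fd, ((incEisG ψ₁ w : ℝ) : ℂ) * ((incEisG ψ₂ w : ℝ) : ℂ) with hL
  set A : ℂ := 4 * (3 / π * (mellin (cplx ψ₁) (-1) * mellin (cplx ψ₂) (-1))) with hA
  -- Step 1: unfold and split
  have hG₁ : ContinuousOn (fun y : ℝ => (((y ^ 2)⁻¹ * ψ₁ y : ℝ) : ℂ)) (Ioi 0) := by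
    intro y hy
    have hy' : (0 : ℝ) < y := hy
    exact (Complex.continuous_ofReal.continuousAt.comp
      (((continuousAt_id.pow 2).inv₀ (by simp [hy'.ne'])).mul h₁.smooth.continuous.continuousAt)).continuousWithinAt
  have hG₂ : ContinuousOn (fun y : ℝ => (((y ^ 2)⁻¹ : ℝ) : ℂ) * ((eisR ψ₁ y : ℝ) : ℂ)) (Ioi 0) := by
    intro y hy
    have hy' : (0 : ℝ) < y := hy
    exact (Complex.continuous_ofReal.continuousAt.comp ((continuousAt_id.pow 2).inv₀ (by simp [hy'.ne']))).continuousWithinAt.mul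
      (Complex.continuous_ofReal.comp_continuousOn h₁.continuousOn_eisR y hy)
  have hI₁ : IntegrableOn (fun y : ℝ => (((y ^ 2)⁻¹ * ψ₁ y : ℝ) : ℂ) * cplx ψ₂ y) (Ioi 0) := by
    refine (h₂.isBumpWeight.integrableOn_mul hG₁).congr_fun (fun y _ => ?_) measurableSet_Ioi
    simp only [cplx]; ring
  have hI₂ : IntegrableOn (fun y : ℝ => (((y ^ 2)⁻¹ : ℝ) : ℂ) * ((eisR ψ₁ y : ℝ) : ℂ) * cplx ψ₂ y) (Ioi 0) := by
    refine (h₂.isBumpWeight.integrableOn_mul hG₂).congr_fun (fun y _ => ?_) measurableSet_Ioi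
    simp only [cplx]; ring
  have hsplit : L = 4 * (∫ y in Ioi (0 : ℝ), (((y ^ 2)⁻¹ * ψ₁ y : ℝ) : ℂ) * cplx ψ₂ y) +
      4 * (∫ y in Ioi (0 : ℝ), (((y ^ 2)⁻¹ : ℝ) : ℂ) * ((eisR ψ₁ y : ℝ) : ℂ) * cplx ψ₂ y) := by
    rw [hL, integral_fd_incEisG_mul_incEisG h₁.isBumpWeight h₂.isBumpWeight]
    have e : ∀ y : ℝ, (((((y ^ 2)⁻¹ * ψ₂ y) * (2 * ψ₁ y + 2 * eisR ψ₁ y) : ℝ) : ℂ)) =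
        2 * ((((y ^ 2)⁻¹ * ψ₁ y : ℝ) : ℂ) * cplx ψ₂ y) + 2 * ((((y ^ 2)⁻¹ : ℝ) : ℂ) * ((eisR ψ₁ y : ℝ) : ℂ) * cplx ψ₂ y) := by
      intro y; simp only [cplx]; push_cast; ring
    simp_rw [e]
    rw [integral_add (hI₁.const_mul 2) (hI₂.const_mul 2), integral_const_mul, integral_const_mul]
    ring
  -- Step 2: the two terms as line integrals
  have hT1 := integral_inv_sq_mul_bump_mul_bump h₁ h₂
  have hT2 := integral_inv_sq_mul_eisR_mul_bump h₁ h₁0 h₂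
  rw [integral_plPhi_shift h₁ h₂, plReg_one] at hT2
  have hT1' : ∫ y in Ioi (0 : ℝ), (((y ^ 2)⁻¹ * ψ₁ y : ℝ) : ℂ) * cplx ψ₂ y =
      c * ∫ τ : ℝ, mLine ψ₁ τ * conj (mLine ψ₂ τ) := by
    rw [hT1]
    congr 1
    refine integral_congr_ae (Eventually.of_forall fun τ => ?_)
    change _ = mLine ψ₁ τ * conj (mLine ψ₂ τ)
    rw [conj_mLine]
    rfl
  have hhalf : ∫ τ : ℝ, plPhi ψ₁ ψ₂ (((1 / 2 : ℝ) : ℂ) + τ * Complex.I) = ∫ τ : ℝ, scatPhi (critS τ) * (mLine ψ₁ τ * mLine ψ₂ τ) := by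
    refine integral_congr_ae (Eventually.of_forall fun τ => ?_); exact plPhi_half ψ₁ ψ₂ τ
  -- Step 3: combine into `L = A + 4c ∫ X`
  have hXint := integrable_plX h₁ h₂
  have hΦint : Integrable fun τ : ℝ => scatPhi (critS τ) * (mLine ψ₁ τ * mLine ψ₂ τ) := by
    have := integrable_plPhi_line h₁ h₂ (σ := 1 / 2) (Or.inl rfl)
    simpa only [plPhi_half] using this
  have hX : ∫ τ : ℝ, plX ψ₁ ψ₂ τ = (∫ τ : ℝ, mLine ψ₁ τ * conj (mLine ψ₂ τ)) +
      ∫ τ : ℝ, scatPhi (critS τ) * (mLine ψ₁ τ * mLine ψ₂ τ) := by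
    unfold plX
    exact integral_add (integrable_mLine_mul_conj h₁ h₂) hΦint
  have hc2π : c * (2 * π) = 1 := by
    rw [hc]; push_cast; field_simp
  have hkey : L = A + 4 * c * ∫ τ : ℝ, plX ψ₁ ψ₂ τ := by
    rw [hsplit, hT1', hT2, hhalf, hX, hA]
    linear_combination (4 * (3 / π * (mellin (cplx ψ₁) (-1) * mellin (cplx ψ₂) (-1)))) * hc2π
  -- Step 4: `∫ X` is real
  have h2c : conj (2 : ℂ) = 2 := map_ofNat _ 2
  have h3c : conj (3 : ℂ) = 3 := map_ofNat _ 3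
  have h4c : conj (4 : ℂ) = 4 := map_ofNat _ 4
  have hLreal : conj L = L := by
    rw [hL, ← integral_conj]
    congr 1; funext w; simp
  have hM : ∀ ψ : ℝ → ℝ, conj (mellin (cplx ψ) (-1)) = mellin (cplx ψ) (-1) := fun ψ => by
    rw [← mellin_cplx_conj]; simp
  have hAreal : conj A = A := by
    rw [hA]; simp only [map_mul, map_div₀, h3c, h4c, Complex.conj_ofReal, hM]
  have hcreal : conj c = c := by rw [hc, Complex.conj_ofReal]
  have hIreal : conj (∫ τ : ℝ, plX ψ₁ ψ₂ τ) = ∫ τ : ℝ, plX ψ₁ ψ₂ τ := by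
    have h := congrArg conj hkey
    rw [hLreal, map_add, hAreal, map_mul, map_mul, h4c, hcreal, hkey] at h
    have hc0 : (4 : ℂ) * c ≠ 0 := by
      rw [hc]; push_cast
      exact mul_ne_zero (by norm_num) (by rw [one_div]; exact inv_ne_zero (mul_ne_zero two_ne_zero hπ0))
    exact (mul_left_cancel₀ hc0 ((add_right_inj A).mp h)).symm
  -- Step 5: the spectral integral
  have hXconj : Integrable fun τ : ℝ => conj (plX ψ₁ ψ₂ τ) :=
    hXint.norm.mono' (Complex.continuous_conj.comp_aestronglyMeasurable hXint.aestronglyMeasurable)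
      (Eventually.of_forall fun τ => by rw [Complex.norm_conj])
  have hE : ∫ r : ℝ, eisCoeff ψ₁ r * conj (eisCoeff ψ₂ r) = 8 * ∫ τ : ℝ, plX ψ₁ ψ₂ τ := by
    simp_rw [eisCoeff_mul_conj_eisCoeff h₁.isBumpWeight h₂.isBumpWeight]
    rw [integral_const_mul, integral_add hXint hXconj, integral_conj, hIreal]
    ring
  rw [hkey, hE, hc]
  push_cast
  field_simp
  ring

end Plancherel

end Literature.NumberTheory.Automorphic
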